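/-
Copyright: public-domain mathematics; formalisation produced inside the b2b autopsy cell `lwe-quantum-autopsy`
(Part 1, generation 14).  Source analysed: Yilei Chen, "Quantum Algorithms for Lattice Problems",
IACR ePrint 2024/555, version of 2024-04-18 (WITHDRAWN by the author: "Step 9 of the algorithm contains a
bug, which I don't know how to fix").  Bib key `ChenQuantumLattice2024`.
-/
import Literature.Computability.Cryptography.ChenQuantumLWEReadoutClass

/-!
# Chen (2024), Step 8: the ORDER of the tolerance threshold of the measurement ceiling for COMPOSITE `Q`

HONEST FRAMING.  The value of this file is a set of kernel-checked THEOREMS about one step of a WITHDRAWN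
quantum algorithm (Chen, ePrint 2024/555 v. 2024-04-18, §3.5.8 Step 8).  It is NOT progress on any summit
problem, breaks nothing, and makes no cryptanalytic claim.

## What was open

(Q) `ChenQuantumLWEMeasurementThreshold` proved the SHARP ORDER of the tolerance `ε` below which every
`ε`-almost-sure general measurement (POVM) of the Step-8 register is constant along Chen's symmetry orbit
when `Q` is PRIME (`step8_povm_ceiling_order_prime`: sufficient `4εQ² < 1`, failure at `ε = 1/Q²`), and for
COMPOSITE `Q` left a window: sufficiency `4ε·(max qᵢ)² < 1` over every pairwise-coprime factorisation
`Q = ∏ qᵢ` (`step8_povm_ceiling_pairwiseCoprime`) against failure only at `1/minFac(Q)²`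
(`step8_povm_ceiling_fails_at_inv_minFac_sq`, the rank-one witness `{|φ7.d⟩⟨φ7.d|, 1 − ·}`); its docstring
records "the exact order for composite `Q` is left open (the rank-one witness gives `minFac`, finer
witnesses may give more)".

## What is proved here (the finer witnesses)

* `Shape.step8_povm_ceiling_fails_at_inv_minFac_divisor_sq` — **for every divisor `C > 1` of `Q`
  (`Q = A·C`, NO coprimality needed) the conclusion of the ceiling FAILS at `ε = 1/minFac(C)²`.**  The witness
  is the two-outcome measurement `{Π, 1 − Π}` where `Π` projects onto the span of the `A^{n+1}` states
  `|φ7.d(b; v′ + L·(x₀ + r, ȳ₀ + s))⟩` with `A·r = 0`, `A·s_t = 0 (mod Q)` — the DIVISOR ORBIT of the instance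
  through the subgroup `C·ℤ_Q` of the offset residues.  On every instance of the class its relative weight is EITHER
  `0` or `1` (slope differences divisible by `C` on every unknown tail coordinate) OR at most `1/minFac(C)²`
  (`Shape.divisorOrbit_almostCertain`, from the closed form `Shape.divisorOrbit_normSq_sum`), so it is `(1/minFac(C)²)`-almost sure on the class, and it separates
  Chen's orbit pair `(b, v′)`, `(b, v′ + L·b)` of (O)/(Q) with certainty.
* `Shape.step8_povm_ceiling_fails_at_inv_prime_sq` — hence failure at `1/p²` for EVERY prime `p ∣ Q`, in
  particular at `1/𝔭(Q)²` for the LARGEST prime factor `𝔭(Q)` — strictly below the rank-one `1/minFac(Q)²`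
  whenever `Q` has two distinct prime factors.
* `Shape.step8_povm_ceiling_order_squarefree` — **for SQUAREFREE `Q` (Chen's `Q = p₂⋯p_κ`, distinct odd
  primes, Cond. C.3 p. 18) the threshold is of EXACT ORDER `1/𝔭(Q)²`:** `4ε·p² < 1` for every prime `p ∣ Q`
  (equivalently `4ε·𝔭(Q)² < 1`) suffices (gen 8, factorisation into the primes of `Q`), and `ε = 1/p²` fails
  for every prime `p ∣ Q`.  This closes the open item of (Q) for squarefree `Q` (factor `4`, as in the prime
  case) and reduces the general case to prime powers: for `Q = ∏ pᵢ^{aᵢ}` the window left is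
  `[1/(4·max pᵢ^{2aᵢ}), 1/𝔭(Q)²]` (the divisor orbit of `C = p^a` only gives `1/p²`).

## Mechanism (why divisors, and why no coprimality)

In the transformed frame `W_{η,m}` of (T) `ChenQuantumLWEReadoutAttained` a member `(β; x, ȳ)` of the dummy
family is `Σ_η coef(η)·W_{η, −2(x+σ_β(η))}` with `|coef| = Q⁻ⁿ` and phases `ψ_Q(−⟨η,ȳ⟩ − 2p₁xσ_β(η) − p₁x²)`
(`phi7d_member_apply`).  Summing `|⟨orbit member (r,s)|ψ⟩|²` over `s ∈ (C·ℤ_Q)ⁿ` is a Parseval identity for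
the subgroup `K = {a : A·a = 0} = C·ℤ_Q` (`#K = A`, `Σ_{a∈K} ψ_Q(d·a) = A·[C·d = 0]`,
`sum_filter_ann_stdAddChar`), which pairs blocks `η, η′` with `C·(η − η′) = 0`; the cross phases then collapse
because `K·K′ = 0` for `K′ = {z : C·z = 0} = A·ℤ_Q` (`mul_eq_zero_of_ann` — the one place where the ring
structure of `ℤ_Q` enters, replacing the Chinese-remainder heuristics; it holds for EVERY factorisation
`Q = A·C`).  The total weight factorises as `Aⁿ·ν²·Q⁻⁴ⁿ · N · Γ` (`divisorOrbit_normSq_sum`) with a lattice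
count `N = #{η : ⟨η, A·β⟩ = A·(x₀ − x′)}` and a character sum `Γ` over `{z ∈ K′ⁿ : ⟨z, β⟩ = 0}`: if `A·β = 0`
on the tail both are full (`N = Qⁿ·[A(x₀−x′) = 0]`, `Γ = Cⁿ·[…]`) and the weight is `0` or `1`; otherwise two
PROPER-subgroup counts (Lagrange in `ℤ_Q` and in `K′ ≅ ℤ_C`: `card_filter_mul_eq_zero_le`,
`card_filter_ann_inf_le`) each lose a factor `minFac(C)`.

References: [ChenQuantumLattice2024] Y. Chen, Quantum Algorithms for Lattice Problems, IACR ePrint 2024/555,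
version 2024-04-18, §3.1 p. 22, Cond. C.3 p. 18, eq. (35) p. 31, §3.5.8 pp. 33–34; [NielsenChuang2010]
M. Nielsen, I. Chuang, Quantum Computation and Quantum Information, CUP 2010, §2.2.6 p. 90 (POVM formalism).
Numerical cross-check of the dichotomy (abstract frame model, stdlib Python, 15 parameter sets incl.
non-coprime `A, C`): cell packet `numerics/threshold_order/`, compute job j051812.
-/

open scoped BigOperators ComplexOrder MatrixOrder
open Matrix Finset

namespace Literature.Computability.Cryptography.Chen2024

/-! ## Part I.  Divisor arithmetic in `ℤ_Q`, `Q = A·C` -/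

section Divisor

variable {Q : ℕ} [NeZero Q] {A C : ℕ}

/-- `A ≠ 0` when `Q = A·C ≠ 0`. [folklore] -/
theorem pos_left_of_eq_mul (hQ : Q = A * C) : 0 < A :=
  Nat.pos_of_ne_zero fun h => NeZero.ne Q (by rw [hQ, h, zero_mul])

/-- `C ≠ 0` when `Q = A·C ≠ 0`. [folklore] -/
theorem pos_right_of_eq_mul (hQ : Q = A * C) : 0 < C :=
  Nat.pos_of_ne_zero fun h => NeZero.ne Q (by rw [hQ, h, mul_zero])

omit [NeZero Q] in
/-- `A·C = 0` in `ℤ_Q`. [folklore] -/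
theorem natCast_mul_natCast_eq_zero (hQ : Q = A * C) : ((A : ZMod Q)) * (C : ZMod Q) = 0 := by
  rw [← Nat.cast_mul, ← hQ, ZMod.natCast_self]

/-- `A·r = 0 ↔ C ∣ r` (on representatives) in `ℤ_{AC}`. [folklore] -/
theorem natCast_mul_eq_zero_iff (hQ : Q = A * C) (r : ZMod Q) : (A : ZMod Q) * r = 0 ↔ C ∣ r.val := by
  have h1 : (A : ZMod Q) * r = ((A * r.val : ℕ) : ZMod Q) := by
    rw [Nat.cast_mul, ZMod.natCast_zmod_val]
  have hA : 0 < A := pos_left_of_eq_mul hQ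
  rw [h1, ZMod.natCast_eq_zero_iff]
  constructor
  · rintro ⟨k, hk⟩
    exact (Nat.mul_dvd_mul_iff_left hA).1 ⟨k, by rw [hk, hQ]⟩
  · rintro ⟨k, hk⟩
    exact ⟨k, by rw [hk, hQ, mul_assoc]⟩

/-- **Annihilators multiply to zero:** `A·r = 0` and `C·z = 0` imply `r·z = 0` in `ℤ_{AC}` (`C ∣ r`, `A ∣ z`).
This is the one ring-theoretic input of the divisor orbit (it replaces the CRT picture and needs NO
coprimality of `A` and `C`). [folklore] -/
theorem mul_eq_zero_of_ann (hQ : Q = A * C) {r z : ZMod Q} (hr : (A : ZMod Q) * r = 0)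
    (hz : (C : ZMod Q) * z = 0) : r * z = 0 := by
  have hQ' : Q = C * A := by rw [hQ, mul_comm]
  obtain ⟨k, hk⟩ := (natCast_mul_eq_zero_iff hQ r).1 hr
  obtain ⟨l, hl⟩ := (natCast_mul_eq_zero_iff hQ' z).1 hz
  rw [← ZMod.natCast_zmod_val r, ← ZMod.natCast_zmod_val z, ← Nat.cast_mul, ZMod.natCast_eq_zero_iff, hk,
    hl, hQ]
  exact ⟨k * l, by ring⟩

/-- **`#{r ∈ ℤ_Q : A·r = 0} = A`** (the subgroup `C·ℤ_Q`). [folklore] -/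
theorem card_filter_ann (hQ : Q = A * C) :
    (Finset.univ.filter fun r : ZMod Q => (A : ZMod Q) * r = 0).card = A := by
  have hC : 0 < C := pos_right_of_eq_mul hQ
  have hlt : ∀ k, k < A → C * k < Q := fun k hk => by
    rw [hQ, mul_comm A C]
    exact Nat.mul_lt_mul_of_pos_left hk hC
  have himg : (Finset.univ.filter fun r : ZMod Q => (A : ZMod Q) * r = 0)
      = (Finset.range A).image fun k => ((C * k : ℕ) : ZMod Q) := by
    ext r
    simp only [Finset.mem_filter, Finset.mem_univ, true_and, Finset.mem_image, Finset.mem_range]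
    rw [natCast_mul_eq_zero_iff hQ]
    constructor
    · rintro ⟨k, hk⟩
      refine ⟨k, ?_, ?_⟩
      · have hv : r.val < Q := ZMod.val_lt r
        rw [hk, hQ, mul_comm A C] at hv
        exact Nat.lt_of_mul_lt_mul_left hv
      · rw [← hk, ZMod.natCast_zmod_val]
    · rintro ⟨k, hk, rfl⟩
      rw [ZMod.val_natCast, Nat.mod_eq_of_lt (hlt k hk)]
      exact dvd_mul_right C k
  rw [himg, Finset.card_image_of_injOn, Finset.card_range]
  intro k₁ hk₁ k₂ hk₂ hk
  have h₁ : k₁ < A := Finset.mem_range.1 (Finset.mem_coe.1 hk₁)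
  have h₂ : k₂ < A := Finset.mem_range.1 (Finset.mem_coe.1 hk₂)
  have hv := congrArg ZMod.val hk
  dsimp only at hv
  rw [ZMod.val_natCast, ZMod.val_natCast, Nat.mod_eq_of_lt (hlt k₁ h₁), Nat.mod_eq_of_lt (hlt k₂ h₂)] at hv
  exact Nat.eq_of_mul_eq_mul_left hC hv

/-- **Character sums over the subgroup `{r : A·r = 0}`:** `Σ_{A·r = 0} ψ_Q(d·r) = A·[C·d = 0]`. [folklore] -/
theorem sum_filter_ann_stdAddChar (hQ : Q = A * C) (d : ZMod Q) :
    ∑ r ∈ Finset.univ.filter (fun r : ZMod Q => (A : ZMod Q) * r = 0), (ZMod.stdAddChar (d * r) : ℂ)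
      = if (C : ZMod Q) * d = 0 then ((A : ℂ)) else 0 := by
  set K := Finset.univ.filter (fun r : ZMod Q => (A : ZMod Q) * r = 0) with hK
  have hmem : ∀ r, r ∈ K ↔ (A : ZMod Q) * r = 0 := fun r => by simp [hK]
  by_cases hd : (C : ZMod Q) * d = 0
  · rw [if_pos hd]
    have h1 : ∀ r ∈ K, (ZMod.stdAddChar (d * r) : ℂ) = 1 := fun r hr => by
      rw [mul_comm, mul_eq_zero_of_ann hQ ((hmem r).1 hr) hd, AddChar.map_zero_eq_one]
    rw [Finset.sum_congr rfl h1, Finset.sum_const, hK, card_filter_ann hQ, nsmul_eq_mul, mul_one]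
  · rw [if_neg hd]
    -- a shift `u = C·x` inside `K` on which `ψ(d·u) ≠ 1`
    obtain ⟨x, hx⟩ := AddChar.ne_one_iff.1 ((ZMod.isPrimitive_stdAddChar Q) hd)
    rw [AddChar.mulShift_apply] at hx
    set u : ZMod Q := (C : ZMod Q) * x with hu
    have huK : ∀ r, r ∈ K → r + u ∈ K := fun r hr => by
      rw [hmem] at hr ⊢
      rw [mul_add, hr, hu, ← mul_assoc, natCast_mul_natCast_eq_zero hQ, zero_mul, add_zero]
    have huK' : ∀ r, r ∈ K → r - u ∈ K := fun r hr => by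
      rw [hmem] at hr ⊢
      rw [mul_sub, hr, hu, ← mul_assoc, natCast_mul_natCast_eq_zero hQ, zero_mul, sub_zero]
    have hshift : ∑ r ∈ K, (ZMod.stdAddChar (d * (r + u)) : ℂ) = ∑ r ∈ K, (ZMod.stdAddChar (d * r) : ℂ) :=
      Finset.sum_nbij' (fun r => r + u) (fun r => r - u) huK huK' (fun r _ => add_sub_cancel_right r u)
        (fun r _ => sub_add_cancel r u) (fun r _ => rfl)
    have hmul : ∑ r ∈ K, (ZMod.stdAddChar (d * (r + u)) : ℂ)
        = (ZMod.stdAddChar (d * u) : ℂ) * ∑ r ∈ K, (ZMod.stdAddChar (d * r) : ℂ) := by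
      rw [Finset.mul_sum]
      refine Finset.sum_congr rfl fun r _ => ?_
      rw [mul_add, AddChar.map_add_eq_mul, mul_comm]
    have hne : (ZMod.stdAddChar (d * u) : ℂ) ≠ 1 := by
      rw [hu, show d * ((C : ZMod Q) * x) = (C : ZMod Q) * d * x by ring]
      exact hx
    have hfix : (1 - (ZMod.stdAddChar (d * u) : ℂ)) * ∑ r ∈ K, (ZMod.stdAddChar (d * r) : ℂ) = 0 := by
      rw [sub_mul, one_mul, ← hmul, hshift, sub_self]
    rcases mul_eq_zero.1 hfix with h0 | h0
    · exact absurd (sub_eq_zero.1 h0).symm hne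
    · exact h0

/-- **Vector form:** `Σ_{s ∈ ℤ_Qⁿ, A·s = 0} ψ_Q(⟨d,s⟩) = Aⁿ·[C·d = 0 coordinatewise]`. [folklore] -/
theorem sum_ite_ann_stdAddChar_vec (hQ : Q = A * C) {n : ℕ} (d : Fin n → ZMod Q) :
    ∑ s : Fin n → ZMod Q, (if ∀ t, (A : ZMod Q) * s t = 0
        then (ZMod.stdAddChar (∑ t, d t * s t) : ℂ) else 0)
      = if ∀ t, (C : ZMod Q) * d t = 0 then ((A : ℂ)) ^ n else 0 := by
  classical
  have hterm : ∀ s : Fin n → ZMod Q,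
      (if ∀ t, (A : ZMod Q) * s t = 0 then (ZMod.stdAddChar (∑ t, d t * s t) : ℂ) else 0)
        = ∏ t, (if (A : ZMod Q) * s t = 0 then (ZMod.stdAddChar (d t * s t) : ℂ) else 0) := by
    intro s
    have hprod : (ZMod.stdAddChar (∑ t, d t * s t) : ℂ) = ∏ t, (ZMod.stdAddChar (d t * s t) : ℂ) := by
      induction (Finset.univ : Finset (Fin n)) using Finset.induction_on with
      | empty => simp
      | insert a u ha ih => rw [Finset.sum_insert ha, Finset.prod_insert ha, AddChar.map_add_eq_mul, ih]
    rw [Finset.prod_ite_zero]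
    simp only [Finset.mem_univ, true_implies]
    by_cases hs : ∀ t, (A : ZMod Q) * s t = 0
    · rw [if_pos hs, if_pos hs, hprod]
    · rw [if_neg hs, if_neg hs]
  simp_rw [hterm]
  rw [← Fintype.piFinset_univ, ← Finset.prod_univ_sum (fun _ => (Finset.univ : Finset (ZMod Q)))
    (fun t a => if (A : ZMod Q) * a = 0 then (ZMod.stdAddChar (d t * a) : ℂ) else 0)]
  have hfac : ∀ t : Fin n, ∑ a : ZMod Q, (if (A : ZMod Q) * a = 0 then (ZMod.stdAddChar (d t * a) : ℂ) else 0)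
      = if (C : ZMod Q) * d t = 0 then ((A : ℂ)) else 0 := fun t => by
    rw [← Finset.sum_filter]
    exact sum_filter_ann_stdAddChar hQ (d t)
  simp_rw [hfac]
  rw [Finset.prod_ite_zero]
  simp only [Finset.mem_univ, true_implies, Finset.prod_const, Finset.card_univ, Fintype.card_fin]

/-- A proper divisor is at most `C/minFac(C)`. [folklore] -/
theorem le_div_minFac_of_dvd {C d : ℕ} (hC : 0 < C) (hd : d ∣ C) (hne : d ≠ C) : d ≤ C / C.minFac := by
  obtain ⟨m, hm⟩ := hd
  have hm0 : 0 < m := Nat.pos_of_ne_zero fun h => hC.ne' (by rw [hm, h, mul_zero])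
  have hm1 : m ≠ 1 := fun h => hne (by rw [hm, h, mul_one])
  have hm2 : 2 ≤ m := by omega
  have hmin : C.minFac ≤ m := Nat.minFac_le_of_dvd hm2 ⟨d, by rw [hm, mul_comm]⟩
  have hdm : d = C / m := (Nat.div_eq_of_eq_mul_left hm0 hm).symm
  rw [hdm]
  exact Nat.div_le_div_left hmin (Nat.minFac_pos C)

/-- The annihilator subgroup `{e : γ·e = 0}` of `ℤ_Q`. [folklore] -/
def mulKer (γ : ZMod Q) : AddSubgroup (ZMod Q) := (AddMonoidHom.mulLeft γ).ker

omit [NeZero Q] in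
/-- Membership in `mulKer`. [folklore] -/
theorem mem_mulKer {γ e : ZMod Q} : e ∈ mulKer γ ↔ γ * e = 0 := AddMonoidHom.mem_ker

/-- Membership in `mulKer γ` is decidable (via `γ·e = 0`). [folklore] -/
instance mulKer.decidablePred (γ : ZMod Q) : DecidablePred (· ∈ mulKer γ) :=
  fun _ => decidable_of_iff _ mem_mulKer.symm

/-- `Nat.card (mulKer γ)` is the filter count. [folklore] -/
theorem natCard_mulKer (γ : ZMod Q) :
    Nat.card (mulKer γ) = (Finset.univ.filter fun e : ZMod Q => γ * e = 0).card := by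
  rw [Nat.card_congr (Equiv.subtypeEquivRight (fun e => (mem_mulKer (γ := γ) (e := e)))),
    Nat.card_eq_fintype_card, Fintype.card_subtype]

/-- `Nat.card (mulKer γ ⊓ mulKer δ)` is the filter count of the conjunction. [folklore] -/
theorem natCard_mulKer_inf (γ δ : ZMod Q) :
    Nat.card ↥(mulKer γ ⊓ mulKer δ) = (Finset.univ.filter fun e : ZMod Q => γ * e = 0 ∧ δ * e = 0).card := by
  have hiff : ∀ e : ZMod Q, e ∈ mulKer γ ⊓ mulKer δ ↔ γ * e = 0 ∧ δ * e = 0 := fun e => by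
    rw [AddSubgroup.mem_inf, mem_mulKer, mem_mulKer]
  rw [Nat.card_congr (Equiv.subtypeEquivRight hiff), Nat.card_eq_fintype_card, Fintype.card_subtype]

/-- **Lagrange bound I:** if `γ ≠ 0` and `C·γ = 0` (so `{e : A·e = 0} ≤ {e : γ·e = 0} < ℤ_Q`) then
`#{e : γ·e = 0} ≤ A·(C/minFac C)`. [folklore] -/
theorem card_filter_mul_eq_zero_le (hQ : Q = A * C) {γ : ZMod Q} (hγ : γ ≠ 0) (hCγ : (C : ZMod Q) * γ = 0) :
    (Finset.univ.filter fun e : ZMod Q => γ * e = 0).card ≤ A * (C / C.minFac) := by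
  have hA : 0 < A := pos_left_of_eq_mul hQ
  have hC : 0 < C := pos_right_of_eq_mul hQ
  -- `K = mulKer A ≤ H = mulKer γ`
  have hle : mulKer (A : ZMod Q) ≤ mulKer γ := fun e he => by
    rw [mem_mulKer] at he ⊢
    rw [mul_comm]
    exact mul_eq_zero_of_ann hQ he hCγ
  have hK : Nat.card (mulKer (A : ZMod Q)) = A := by rw [natCard_mulKer, card_filter_ann hQ]
  have hAd : A ∣ Nat.card (mulKer γ) := by
    have h := AddSubgroup.card_dvd_of_le hle
    rwa [hK] at h
  have hHQ : Nat.card (mulKer γ) ∣ Q := by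
    have h := AddSubgroup.card_addSubgroup_dvd_card (mulKer γ)
    rwa [Nat.card_zmod] at h
  have hne : Nat.card (mulKer γ) ≠ Q := by
    intro hEq
    have htop : mulKer γ = ⊤ := AddSubgroup.eq_top_of_card_eq _ (by rw [hEq, Nat.card_zmod])
    have h1 : (1 : ZMod Q) ∈ mulKer γ := by rw [htop]; exact AddSubgroup.mem_top 1
    rw [mem_mulKer, mul_one] at h1
    exact hγ h1
  obtain ⟨d, hd⟩ := hAd
  have hdC : d ∣ C := by
    have h := hHQ
    rw [hd, hQ] at h
    exact Nat.dvd_of_mul_dvd_mul_left hA h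
  have hdne : d ≠ C := fun h => hne (by rw [hd, h, hQ])
  rw [← natCard_mulKer, hd]
  exact Nat.mul_le_mul_left A (le_div_minFac_of_dvd hC hdC hdne)

/-- **Lagrange bound II (inside `K′ = {e : C·e = 0} ≅ ℤ_C`):** if `A·β ≠ 0` then
`#{e : C·e = 0 ∧ β·e = 0} ≤ C/minFac C`. [folklore] -/
theorem card_filter_ann_inf_le (hQ : Q = A * C) {β : ZMod Q} (hβ : (A : ZMod Q) * β ≠ 0) :
    (Finset.univ.filter fun e : ZMod Q => (C : ZMod Q) * e = 0 ∧ β * e = 0).card ≤ C / C.minFac := by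
  have hC : 0 < C := pos_right_of_eq_mul hQ
  have hQ' : Q = C * A := by rw [hQ, mul_comm]
  have hle : mulKer (C : ZMod Q) ⊓ mulKer β ≤ mulKer (C : ZMod Q) := inf_le_left
  have hK : Nat.card (mulKer (C : ZMod Q)) = C := by rw [natCard_mulKer, card_filter_ann hQ']
  have hdvd : Nat.card ↥(mulKer (C : ZMod Q) ⊓ mulKer β) ∣ C := by
    have h := AddSubgroup.card_dvd_of_le hle
    rwa [hK] at h
  have hne : Nat.card ↥(mulKer (C : ZMod Q) ⊓ mulKer β) ≠ C := by
    intro hEq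
    have heq : mulKer (C : ZMod Q) ⊓ mulKer β = mulKer (C : ZMod Q) :=
      AddSubgroup.eq_of_le_of_card_ge hle (by rw [hEq, hK])
    have hAK : ((A : ZMod Q)) ∈ mulKer (C : ZMod Q) := by
      rw [mem_mulKer, mul_comm]
      exact natCast_mul_natCast_eq_zero hQ
    rw [← heq, AddSubgroup.mem_inf, mem_mulKer, mem_mulKer] at hAK
    exact hβ (by rw [mul_comm]; exact hAK.2)
  rw [← natCard_mulKer_inf]
  exact le_div_minFac_of_dvd hC hdvd hne

/-- **Affine fibres are no bigger than the kernel** (with a linear side condition `δ·e = 0`):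
`#{e : δe = 0 ∧ γe + c₀ = c} ≤ #{e : δe = 0 ∧ γe = 0}` (translate by a solution). [folklore] -/
theorem card_filter_affine_le (δ γ c₀ c : ZMod Q) :
    (Finset.univ.filter fun e : ZMod Q => δ * e = 0 ∧ γ * e + c₀ = c).card
      ≤ (Finset.univ.filter fun e : ZMod Q => δ * e = 0 ∧ γ * e = 0).card := by
  classical
  by_cases hne : (Finset.univ.filter fun e : ZMod Q => δ * e = 0 ∧ γ * e + c₀ = c).Nonempty
  · obtain ⟨e₁, he₁⟩ := hne
    have h₁ := (Finset.mem_filter.1 he₁).2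
    refine Finset.card_le_card_of_injOn (fun e => e - e₁) (fun e he => ?_) ?_
    · have he' := (Finset.mem_filter.1 (Finset.mem_coe.1 he)).2
      refine Finset.mem_coe.2 (Finset.mem_filter.2 ⟨Finset.mem_univ _, ?_, ?_⟩)
      · rw [mul_sub, he'.1, h₁.1, sub_zero]
      · rw [mul_sub]
        linear_combination he'.2 - h₁.2
    · intro e _ e' _ hee'
      simpa using hee'
  · rw [Finset.not_nonempty_iff_eq_empty.1 hne, Finset.card_empty]
    exact Nat.zero_le _

/-- **Splitting off one coordinate.**  Let `P` be a property of vectors `z ∈ ℤ_Qⁿ` that forces `R` on every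
coordinate, and suppose that for every `z` with all coordinates in `R` at most `B` values `e` at coordinate
`t₀` complete `z` into `P`.  Then `#R · #{z : P z} ≤ #Rⁿ · B` (count pairs `(z, e)` with `P z ∧ R e` through
the involution `(z, e) ↦ (z[t₀ ↦ e], z t₀)`). [folklore] -/
theorem card_mul_card_filter_le {n : ℕ} (t₀ : Fin n) (P : (Fin n → ZMod Q) → Prop) [DecidablePred P]
    (R : ZMod Q → Prop) [DecidablePred R] (hPR : ∀ z, P z → ∀ t, R (z t)) (B : ℕ)
    (hB : ∀ z : Fin n → ZMod Q, (∀ t, R (z t)) →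
      (Finset.univ.filter fun e : ZMod Q => P (Function.update z t₀ e)).card ≤ B) :
    (Finset.univ.filter R).card * (Finset.univ.filter P).card ≤ (Finset.univ.filter R).card ^ n * B := by
  classical
  -- pairs `(z, e)` with `P z ∧ R e`
  have hpairs : (Finset.univ.filter R).card * (Finset.univ.filter P).card
      = ∑ p : (Fin n → ZMod Q) × ZMod Q, (if P p.1 ∧ R p.2 then 1 else 0) := by
    rw [mul_comm, ← Finset.card_product, ← Finset.card_filter]
    congr 1
    ext p
    simp only [Finset.mem_product, Finset.mem_filter, Finset.mem_univ, true_and]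
  -- the involution
  let ι : (Fin n → ZMod Q) × ZMod Q → (Fin n → ZMod Q) × ZMod Q :=
    fun p => (Function.update p.1 t₀ p.2, p.1 t₀)
  have hι : ∀ p, ι (ι p) = p := by
    rintro ⟨z, e⟩
    simp only [ι, Function.update_idem, Function.update_self, Function.update_eq_self]
  let σ : (Fin n → ZMod Q) × ZMod Q ≃ (Fin n → ZMod Q) × ZMod Q :=
    ⟨ι, ι, hι, hι⟩
  have hsum : ∑ p : (Fin n → ZMod Q) × ZMod Q, (if P p.1 ∧ R p.2 then 1 else 0)
      = ∑ p : (Fin n → ZMod Q) × ZMod Q, (if P (Function.update p.1 t₀ p.2) ∧ R (p.1 t₀) then 1 else 0) := by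
    refine Fintype.sum_equiv σ _ _ fun p => ?_
    obtain ⟨z, e⟩ := p
    simp only [σ, ι, Equiv.coe_fn_mk, Function.update_idem, Function.update_eq_self, Function.update_self]
  -- bound the permuted sum
  have hle : ∀ p : (Fin n → ZMod Q) × ZMod Q,
      (if P (Function.update p.1 t₀ p.2) ∧ R (p.1 t₀) then 1 else 0)
        ≤ (if ∀ t, R (p.1 t) then (if P (Function.update p.1 t₀ p.2) then 1 else 0) else 0) := by
    rintro ⟨z, e⟩
    dsimp only
    by_cases hP : P (Function.update z t₀ e) ∧ R (z t₀)
    · have hall : ∀ t, R (z t) := by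
        intro t
        by_cases ht : t = t₀
        · rw [ht]; exact hP.2
        · have h := hPR _ hP.1 t
          rwa [Function.update_of_ne ht] at h
      rw [if_pos hP, if_pos hall, if_pos hP.1]
    · rw [if_neg hP]
      exact Nat.zero_le _
  rw [hpairs, hsum]
  refine (Finset.sum_le_sum fun p _ => hle p).trans ?_
  rw [Fintype.sum_prod_type]
  simp_rw [Finset.sum_ite_irrel, Finset.sum_const_zero, Finset.sum_boole, Nat.cast_id]
  -- `Σ_z [∀ t, R (z t)] · #{e : P (z[t₀ ↦ e])} ≤ #{z : ∀ t, R (z t)} · B`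
  have hstep : ∑ z : Fin n → ZMod Q,
      (if ∀ t, R (z t) then (Finset.univ.filter fun e : ZMod Q => P (Function.update z t₀ e)).card else 0)
        ≤ ∑ z : Fin n → ZMod Q, (if ∀ t, R (z t) then B else 0) := by
    refine Finset.sum_le_sum fun z _ => ?_
    by_cases hz : ∀ t, R (z t)
    · rw [if_pos hz, if_pos hz]; exact hB z hz
    · rw [if_neg hz, if_neg hz]
  refine hstep.trans ?_
  rw [← Finset.sum_filter, Finset.sum_const, smul_eq_mul]
  refine Nat.mul_le_mul_right B (le_of_eq ?_)
  have hpi : (Finset.univ.filter fun z : Fin n → ZMod Q => ∀ t, R (z t))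
      = Fintype.piFinset fun _ : Fin n => Finset.univ.filter R := by
    ext z
    simp only [Finset.mem_filter, Finset.mem_univ, true_and, Fintype.mem_piFinset]
  rw [hpi, Fintype.card_piFinset, Finset.prod_const, Finset.card_univ, Fintype.card_fin]

end Divisor

/-! ## Part II.  The two-outcome frame measurement `{Π, 1 − Π}` -/

namespace POVM

section FrameBinary

variable {X ι : Type*} [Fintype X] [DecidableEq X] [Fintype ι] [DecidableEq ι]

omit [DecidableEq X] [DecidableEq ι] in
/-- A sum of the effects `|w_j⟩⟨w_j|/⟨w_j|w_j⟩` is positive semidefinite. [cite: NielsenChuang2010, §2.2.6 p. 90] -/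
theorem posSemidef_sum_projEffect (w : ι → X → ℂ) : (∑ j, projEffect (w j)).PosSemidef :=
  Finset.sum_induction _ Matrix.PosSemidef (fun _ _ ha hb => ha.add hb) Matrix.PosSemidef.zero
    fun j _ => posSemidef_projEffect (w j)

/-- **The two-outcome frame measurement `{Π, 1 − Π}`** of an orthogonal frame `(w_j)` of common squared
norm `ν > 0`: outcome `0` has effect `Π = Σ_j |w_j⟩⟨w_j|/ν` (the projector onto the span), outcome `1` the
complement `1 − Π`. [cite: NielsenChuang2010, §2.2.6 p. 90] -/
noncomputable def ofFrameBinary (w : ι → X → ℂ) {ν : ℝ} (hν : 0 < ν)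
    (horth : ∀ j k, star (w j) ⬝ᵥ w k = if j = k then ((ν : ℝ) : ℂ) else 0) : POVM X (Fin 2) where
  effect := fun k => if k = 0 then ∑ j, projEffect (w j) else 1 - ∑ j, projEffect (w j)
  posSemidef := fun k => by
    by_cases hk : k = 0
    · rw [if_pos hk]
      exact posSemidef_sum_projEffect w
    · rw [if_neg hk]
      exact posSemidef_one_sub_sum_projEffect w hν horth
  sum_eq_one := by
    rw [Fin.sum_univ_two, if_pos rfl, if_neg (by decide)]
    exact add_sub_cancel _ _

/-- Weight of outcome `0` of `{Π, 1 − Π}` on `φ`: `Σ_j ‖⟨w_j|φ⟩‖²/ν`. [cite: NielsenChuang2010, §2.2.6 p. 90] -/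
theorem ofFrameBinary_weight_zero (w : ι → X → ℂ) {ν : ℝ} (hν : 0 < ν)
    (horth : ∀ j k, star (w j) ⬝ᵥ w k = if j = k then ((ν : ℝ) : ℂ) else 0) (φ : X → ℂ) :
    (ofFrameBinary w hν horth).weight φ 0 = (((∑ j, ν⁻¹ * ‖star (w j) ⬝ᵥ φ‖ ^ 2 : ℝ)) : ℂ) := by
  show star φ ⬝ᵥ ((if (0 : Fin 2) = 0 then ∑ j, projEffect (w j) else 1 - ∑ j, projEffect (w j)) *ᵥ φ) = _
  rw [if_pos rfl, Matrix.sum_mulVec, dotProduct_sum]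
  simp_rw [dotProduct_projEffect_mulVec_self]
  push_cast
  refine Finset.sum_congr rfl fun j _ => ?_
  rw [horth j j, if_pos rfl, Complex.ofReal_re]

/-- Weight of outcome `1` of `{Π, 1 − Π}` on `φ`: the deficit `⟨φ|φ⟩ − Σ_j ‖⟨w_j|φ⟩‖²/ν`.
[cite: NielsenChuang2010, §2.2.6 p. 90] -/
theorem ofFrameBinary_weight_one_re (w : ι → X → ℂ) {ν : ℝ} (hν : 0 < ν)
    (horth : ∀ j k, star (w j) ⬝ᵥ w k = if j = k then ((ν : ℝ) : ℂ) else 0) (φ : X → ℂ) :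
    ((ofFrameBinary w hν horth).weight φ 1).re = (star φ ⬝ᵥ φ).re - ∑ j, ν⁻¹ * ‖star (w j) ⬝ᵥ φ‖ ^ 2 := by
  have h := (ofFrameBinary w hν horth).sum_weight_re φ
  rw [Fin.sum_univ_two, ofFrameBinary_weight_zero, Complex.ofReal_re] at h
  linarith

end FrameBinary

end POVM

/-! ## Part III.  Members of the full dummy family in the transformed frame -/

namespace Shape

variable (S : Shape)

/-- The member `(β; x, ȳ)` of the FULL dummy family (`T = univ` in (S)/(T)/(U)): the Step-8 register state
`|φ7.d(famBT univ β, v′ + L·(x, ȳ))⟩` — slopes `(−1, 2p₁(b_{t+1}/(2p₁) + β_t))`, offset `v′ + L·(x, ȳ)`.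
[cite: ChenQuantumLattice2024, §3.1 p. 22, eq. (35) p. 31] -/
noncomputable abbrev uKet (β : Fin S.n → ZMod S.Q) (x : ZMod S.Q) (yb : Fin S.n → ZMod S.Q) :
    (Fin (S.n + 1) → ZMod S.M) → ℂ :=
  (S.inst (S.famBT Finset.univ β) (S.vOf (S.xyv x yb))).phi7d

/-- **Overlap of two members in the transformed frame:**
`⟨β₁;x₁,ȳ₁ | β₂;x₂,ȳ₂⟩ = Σ_η [m_{β₁,x₁}(η) = m_{β₂,x₂}(η)]·conj coef₁(η)·coef₂(η)·ν` ((T) `phi7d_member_apply`,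
`frameVec_dotProduct_member`). [cite: ChenQuantumLattice2024, eq. (35) p. 31, §3.5.8 pp. 33–34] -/
theorem star_uKet_dotProduct_uKet (h : S.Admissible) (β₁ : Fin S.n → ZMod S.Q) (x₁ : ZMod S.Q)
    (y₁ : Fin S.n → ZMod S.Q) (β₂ : Fin S.n → ZMod S.Q) (x₂ : ZMod S.Q) (y₂ : Fin S.n → ZMod S.Q) :
    star (S.uKet β₁ x₁ y₁) ⬝ᵥ S.uKet β₂ x₂ y₂
      = ∑ η : Fin S.n → ZMod S.Q, if S.mOf Finset.univ β₁ x₁ η = S.mOf Finset.univ β₂ x₂ η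
          then (starRingEnd ℂ) (S.coefOf Finset.univ β₁ x₁ y₁ η)
            * (S.coefOf Finset.univ β₂ x₂ y₂ η * ((S.frameNormSq : ℝ) : ℂ)) else 0 := by
  have hφ : S.uKet β₁ x₁ y₁
      = ∑ η : Fin S.n → ZMod S.Q, S.coefOf Finset.univ β₁ x₁ y₁ η • S.frameVec (η, S.mOf Finset.univ β₁ x₁ η) := by
    funext p
    rw [Finset.sum_apply]
    simp_rw [Pi.smul_apply, smul_eq_mul]
    exact S.phi7d_member_apply Finset.univ β₁ x₁ y₁ p
  rw [hφ, star_sum, sum_dotProduct]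
  refine Finset.sum_congr rfl fun η _ => ?_
  rw [star_smul, smul_dotProduct, smul_eq_mul, Complex.star_def,
    S.frameVec_dotProduct_member h Finset.univ β₂ x₂ y₂ (η, S.mOf Finset.univ β₁ x₁ η)]
  dsimp only
  rw [mul_ite, mul_zero]

/-- `σ_B` is additive: `σ_B(η − z) = σ_B(η) − σ_B(z)`. [folklore] -/
theorem sig_sub (B : Fin S.n → ℤ) (η z : Fin S.n → ZMod S.Q) : S.sig B (η - z) = S.sig B η - S.sig B z := by
  unfold sig
  rw [← Finset.sum_sub_distrib]
  exact Finset.sum_congr rfl fun t _ => by rw [Pi.sub_apply, sub_mul]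

/-- `r·σ_B(z) = 0` when `A·r = 0` and `C·z = 0` coordinatewise (`Q = A·C`). [folklore] -/
theorem mul_sig_eq_zero {A C : ℕ} (hQ : (S.Q : ℕ) = A * C) (B : Fin S.n → ℤ) {r : ZMod S.Q}
    (hr : (A : ZMod S.Q) * r = 0) {z : Fin S.n → ZMod S.Q} (hz : ∀ t, (C : ZMod S.Q) * z t = 0) :
    r * S.sig B z = 0 := by
  unfold sig
  rw [Finset.mul_sum]
  exact Finset.sum_eq_zero fun t _ => by rw [← mul_assoc, mul_eq_zero_of_ann hQ hr (hz t), zero_mul]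

/-- **When do two members share the head datum of block `η`?**  `m_{β₁,x₁}(η) = m_{β₂,x₂}(η)` iff
`x₁ + ⟨η,β₁⟩ = x₂ + ⟨η,β₂⟩` (`Q` odd, (R) `eq_zero_of_two_mul_eq_zero`). [cite: ChenQuantumLattice2024, eq. (35) p. 31] -/
theorem mOf_eq_mOf_iff (h : S.Admissible) (β₁ β₂ : Fin S.n → ZMod S.Q) (x₁ x₂ : ZMod S.Q)
    (η : Fin S.n → ZMod S.Q) :
    S.mOf Finset.univ β₁ x₁ η = S.mOf Finset.univ β₂ x₂ η ↔ x₁ + ∑ t, η t * β₁ t = x₂ + ∑ t, η t * β₂ t := by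
  unfold mOf
  rw [S.sig_BfamT, S.sig_BfamT]
  constructor
  · intro hm
    have h2 := eq_zero_of_two_mul_eq_zero h.odd_Q
      (a := (x₁ + ∑ t, η t * β₁ t) - (x₂ + ∑ t, η t * β₂ t)) (by linear_combination (-1 : ZMod S.Q) * hm)
    exact sub_eq_zero.1 h2
  · intro he
    linear_combination (-2 : ZMod S.Q) * he

/-- A tail shift multiplies the coefficient by a character: `coef_{β,x,ȳ+s}(η) = coef_{β,x,ȳ}(η)·ψ_Q(−⟨η,s⟩)`.
[cite: ChenQuantumLattice2024, eq. (35) p. 31] -/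
theorem coefOf_add_tail (β : Fin S.n → ZMod S.Q) (x : ZMod S.Q) (yb s η : Fin S.n → ZMod S.Q) :
    S.coefOf Finset.univ β x (yb + s) η
      = S.coefOf Finset.univ β x yb η * ZMod.stdAddChar (-(∑ t, η t * s t)) := by
  unfold coefOf
  have hsplit : -(∑ t, η t * (yb + s) t) = -(∑ t, η t * yb t) + -(∑ t, η t * s t) := by
    rw [← neg_add, ← Finset.sum_add_distrib]
    congr 1
    exact Finset.sum_congr rfl fun t _ => by rw [Pi.add_apply, mul_add]
  rw [hsplit, AddChar.map_add_eq_mul]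
  ring

/-- The conjugate coefficient: `conj coef_{β,x,ȳ}(η) = Q⁻ⁿ·ψ_Q(⟨η,ȳ⟩)·ψ_Q(2p₁xσ_β(η) + p₁x²)`. [folklore] -/
theorem conj_coefOf (β : Fin S.n → ZMod S.Q) (x : ZMod S.Q) (yb η : Fin S.n → ZMod S.Q) :
    (starRingEnd ℂ) (S.coefOf Finset.univ β x yb η)
      = (1 / ((S.Q : ℕ) : ℂ) ^ S.n) * ((ZMod.stdAddChar (∑ t, η t * yb t) : ℂ)
        * ZMod.stdAddChar (2 * ((S.p₁ : ℕ) : ZMod S.Q) * x * S.sig (S.BfamT Finset.univ β) η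
            + ((S.p₁ : ℕ) : ZMod S.Q) * x ^ 2)) := by
  unfold coefOf
  rw [map_mul, map_mul, ← AddChar.map_neg_eq_conj, ← AddChar.map_neg_eq_conj, neg_neg, map_div₀, map_one,
    map_pow, map_natCast, show -(-(2 * ((S.p₁ : ℕ) : ZMod S.Q) * x * S.sig (S.BfamT Finset.univ β) η)
      - ((S.p₁ : ℕ) : ZMod S.Q) * x ^ 2) = 2 * ((S.p₁ : ℕ) : ZMod S.Q) * x * S.sig (S.BfamT Finset.univ β) η
      + ((S.p₁ : ℕ) : ZMod S.Q) * x ^ 2 by ring]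

/-- **Same member, two tails:** `conj coef_{β,x,ȳ₁}(η)·coef_{β,x,ȳ₂}(η) = Q⁻²ⁿ·ψ_Q(⟨ȳ₁ − ȳ₂, η⟩)` (the
`x`-phases cancel). [folklore] -/
theorem conj_coefOf_mul_coefOf (β : Fin S.n → ZMod S.Q) (x : ZMod S.Q) (y₁ y₂ η : Fin S.n → ZMod S.Q) :
    (starRingEnd ℂ) (S.coefOf Finset.univ β x y₁ η) * S.coefOf Finset.univ β x y₂ η
      = (1 / ((S.Q : ℕ) : ℂ) ^ S.n) ^ 2 * (ZMod.stdAddChar (∑ t, (y₁ - y₂) t * η t) : ℂ) := by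
  rw [S.conj_coefOf, coefOf]
  have hsum : ∑ t, (y₁ - y₂) t * η t = ∑ t, η t * y₁ t - ∑ t, η t * y₂ t := by
    rw [← Finset.sum_sub_distrib]
    exact Finset.sum_congr rfl fun t _ => by rw [Pi.sub_apply]; ring
  rw [hsum, show ∀ a b c d : ℂ, (1 / ((S.Q : ℕ) : ℂ) ^ S.n) * (a * b) * ((1 / ((S.Q : ℕ) : ℂ) ^ S.n) * (c * d))
      = (1 / ((S.Q : ℕ) : ℂ) ^ S.n) ^ 2 * ((a * b) * (c * d)) from fun a b c d => by ring,
    ← AddChar.map_add_eq_mul, ← AddChar.map_add_eq_mul, ← AddChar.map_add_eq_mul]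
  congr 2
  ring

/-- **Same member, shifted block:** `conj coef_{β,x,ȳ}(η)·coef_{β,x,ȳ}(η − z) = Q⁻²ⁿ·ψ_Q(⟨z,ȳ⟩ + 2p₁xσ_β(z))`
— independent of `η` (`σ_β` additive). [folklore] -/
theorem conj_coefOf_mul_coefOf_sub (β : Fin S.n → ZMod S.Q) (x : ZMod S.Q) (yb η z : Fin S.n → ZMod S.Q) :
    (starRingEnd ℂ) (S.coefOf Finset.univ β x yb η) * S.coefOf Finset.univ β x yb (η - z)
      = (1 / ((S.Q : ℕ) : ℂ) ^ S.n) ^ 2 * (ZMod.stdAddChar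
          (∑ t, z t * yb t + 2 * ((S.p₁ : ℕ) : ZMod S.Q) * x * S.sig (S.BfamT Finset.univ β) z) : ℂ) := by
  rw [S.conj_coefOf, coefOf, S.sig_sub]
  have hsum : ∑ t, (η - z) t * yb t = ∑ t, η t * yb t - ∑ t, z t * yb t := by
    rw [← Finset.sum_sub_distrib]
    exact Finset.sum_congr rfl fun t _ => by rw [Pi.sub_apply, sub_mul]
  rw [hsum, show ∀ a b c d : ℂ, (1 / ((S.Q : ℕ) : ℂ) ^ S.n) * (a * b) * ((1 / ((S.Q : ℕ) : ℂ) ^ S.n) * (c * d))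
      = (1 / ((S.Q : ℕ) : ℂ) ^ S.n) ^ 2 * ((a * b) * (c * d)) from fun a b c d => by ring,
    ← AddChar.map_add_eq_mul, ← AddChar.map_add_eq_mul, ← AddChar.map_add_eq_mul]
  congr 2
  ring

/-- Conjugate form: `coef_{β,x,ȳ}(η)·conj coef_{β,x,ȳ}(η − z) = Q⁻²ⁿ·ψ_Q(−⟨z,ȳ⟩ − 2p₁xσ_β(z))`. [folklore] -/
theorem coefOf_mul_conj_coefOf_sub (β : Fin S.n → ZMod S.Q) (x : ZMod S.Q) (yb η z : Fin S.n → ZMod S.Q) :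
    S.coefOf Finset.univ β x yb η * (starRingEnd ℂ) (S.coefOf Finset.univ β x yb (η - z))
      = (1 / ((S.Q : ℕ) : ℂ) ^ S.n) ^ 2 * (ZMod.stdAddChar
          (-(∑ t, z t * yb t) - 2 * ((S.p₁ : ℕ) : ZMod S.Q) * x * S.sig (S.BfamT Finset.univ β) z) : ℂ) := by
  have hc := congrArg (starRingEnd ℂ) (S.conj_coefOf_mul_coefOf_sub β x yb η z)
  rw [map_mul, Complex.conj_conj] at hc
  rw [hc, map_mul, ← AddChar.map_neg_eq_conj, map_pow, map_div₀, map_one, map_pow, map_natCast]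
  congr 2
  ring

/-- **Gram matrix of one dummy family:** `⟨β;x₁,ȳ₁ | β;x₂,ȳ₂⟩ = (ν/Qⁿ)·[(x₁,ȳ₁) = (x₂,ȳ₂)]` — the `Q^{n+1}`
members with the same slopes are pairwise orthogonal ((O) `phi7_orthogonal_of_offset`, here recovered from
the frame expansion). [cite: ChenQuantumLattice2024, eq. (35) p. 31, §3.5.8 pp. 33–34] -/
theorem star_uKet_dotProduct_uKet_same (h : S.Admissible) (β : Fin S.n → ZMod S.Q) (x₁ x₂ : ZMod S.Q)
    (y₁ y₂ : Fin S.n → ZMod S.Q) :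
    star (S.uKet β x₁ y₁) ⬝ᵥ S.uKet β x₂ y₂
      = if x₁ = x₂ ∧ y₁ = y₂ then (((S.frameNormSq / ((S.Q : ℕ) : ℝ) ^ S.n : ℝ)) : ℂ) else 0 := by
  classical
  rw [S.star_uKet_dotProduct_uKet h]
  by_cases hx : x₁ = x₂
  · subst hx
    simp only [true_and, ↓reduceIte]
    have hterm : ∀ η : Fin S.n → ZMod S.Q, (starRingEnd ℂ) (S.coefOf Finset.univ β x₁ y₁ η)
        * (S.coefOf Finset.univ β x₁ y₂ η * ((S.frameNormSq : ℝ) : ℂ))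
        = ((S.frameNormSq : ℝ) : ℂ) * (1 / ((S.Q : ℕ) : ℂ) ^ S.n) ^ 2
          * (ZMod.stdAddChar (∑ t, (y₁ - y₂) t * η t) : ℂ) := by
      intro η
      rw [← mul_assoc, S.conj_coefOf_mul_coefOf]
      ring
    simp_rw [hterm]
    rw [← Finset.mul_sum, sum_stdAddChar_linForm]
    by_cases hy : y₁ = y₂
    · subst hy
      rw [if_pos (sub_self y₁), if_pos rfl]
      have hQ : ((S.Q : ℕ) : ℂ) ≠ 0 := by exact_mod_cast S.Q.ne_zero
      push_cast
      field_simp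
    · rw [if_neg (sub_ne_zero.2 hy), if_neg hy, mul_zero]
  · have hF : ¬ (x₁ = x₂ ∧ y₁ = y₂) := fun h2 => hx h2.1
    rw [if_neg hF]
    refine Finset.sum_eq_zero fun η _ => ?_
    rw [if_neg]
    rw [S.mOf_eq_mOf_iff h]
    exact fun he => hx (add_right_cancel he)

/-! ## Part IV.  The divisor orbit and its two-outcome measurement -/

/-- The index set of the DIVISOR ORBIT for `A` (`Q = A·C`): residues `(r, s) ∈ ℤ_Q × ℤ_Qⁿ` killed by `A`,
i.e. multiples of `C` (`A^{n+1}` of them, `card_filter_ann`). [folklore] -/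
abbrev OrbitIdx (A : ℕ) : Type :=
  {p : ZMod S.Q × (Fin S.n → ZMod S.Q) // (A : ZMod S.Q) * p.1 = 0 ∧ ∀ t, (A : ZMod S.Q) * p.2 t = 0}

/-- **The divisor orbit** of the member `(0; x₀, ȳ₀)` (true slopes): the states
`|φ7.d(b, v′ + L·(x₀ + r, ȳ₀ + s))⟩` with `A·r = 0`, `A·s = 0` — the offsets `v′ + L·(x₀,ȳ₀) + L·C·(ℤ_Q)^{n+1}`.
[cite: ChenQuantumLattice2024, eq. (35) p. 31, §3.5.8 p. 34] -/
noncomputable def orbitVec (A : ℕ) (x₀ : ZMod S.Q) (y₀ : Fin S.n → ZMod S.Q) (j : S.OrbitIdx A) :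
    (Fin (S.n + 1) → ZMod S.M) → ℂ :=
  S.uKet 0 (x₀ + j.1.1) (y₀ + j.1.2)

/-- The divisor orbit is an orthogonal frame of common squared norm `ν/Qⁿ`. [cite: ChenQuantumLattice2024, §3.5.8 pp. 33–34] -/
theorem orbit_orth (h : S.Admissible) (A : ℕ) (x₀ : ZMod S.Q) (y₀ : Fin S.n → ZMod S.Q)
    (j k : S.OrbitIdx A) :
    star (S.orbitVec A x₀ y₀ j) ⬝ᵥ S.orbitVec A x₀ y₀ k
      = if j = k then (((S.frameNormSq / ((S.Q : ℕ) : ℝ) ^ S.n : ℝ)) : ℂ) else 0 := by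
  unfold orbitVec
  rw [S.star_uKet_dotProduct_uKet_same h]
  by_cases hjk : j = k
  · subst hjk
    rw [if_pos ⟨rfl, rfl⟩, if_pos rfl]
  · rw [if_neg hjk, if_neg]
    rintro ⟨h1, h2⟩
    exact hjk (Subtype.ext (Prod.ext (add_left_cancel h1) (add_left_cancel h2)))

/-- `ν/Qⁿ > 0`. [folklore] -/
theorem frameNormSq_div_pos : 0 < S.frameNormSq / ((S.Q : ℕ) : ℝ) ^ S.n :=
  div_pos S.frameNormSq_pos (pow_pos (by exact_mod_cast S.Q.pos) _)

/-- **THE DIVISOR-ORBIT MEASUREMENT** `{Π, 1 − Π}`, `Π` = the projector onto the span of the divisor orbit.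
[cite: ChenQuantumLattice2024, §3.5.8 pp. 33–34; NielsenChuang2010, §2.2.6 p. 90] -/
noncomputable def orbitPOVM (h : S.Admissible) (A : ℕ) (x₀ : ZMod S.Q) (y₀ : Fin S.n → ZMod S.Q) :
    POVM (Fin (S.n + 1) → ZMod S.M) (Fin 2) :=
  POVM.ofFrameBinary (S.orbitVec A x₀ y₀) S.frameNormSq_div_pos (S.orbit_orth h A x₀ y₀)

/-! ## Part V.  The weight of the divisor orbit on a member: `Σ_j |⟨O_j|ψ⟩|² = Aⁿ·ν²·Q⁻⁴ⁿ·N·Γ` -/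

/-- `‖ψ_Q(a)‖ = 1`. [folklore] -/
theorem norm_stdAddChar_eq_one (a : ZMod S.Q) : ‖(ZMod.stdAddChar a : ℂ)‖ = 1 := by
  rw [ZMod.stdAddChar_apply, Circle.norm_coe]

/-- The block amplitude of the divisor orbit against the member `(β; x′, ȳ′)`:
`F_r(η) = [r = x′ − x₀ + ⟨η,β⟩]·conj coef_{0,x₀+r,ȳ₀}(η)·coef_{β,x′,ȳ′}(η)·ν`. [folklore] -/
noncomputable def orbF (x₀ : ZMod S.Q) (y₀ β : Fin S.n → ZMod S.Q) (x' : ZMod S.Q)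
    (y' : Fin S.n → ZMod S.Q) (r : ZMod S.Q) (η : Fin S.n → ZMod S.Q) : ℂ :=
  if r = x' - x₀ + ∑ t, η t * β t then
    (starRingEnd ℂ) (S.coefOf Finset.univ 0 (x₀ + r) y₀ η)
      * (S.coefOf Finset.univ β x' y' η * ((S.frameNormSq : ℝ) : ℂ))
  else 0

/-- The character sum `Γ` of the divisor orbit against the member `(β; x′, ȳ′)` (over the tail shifts
`z` with `C·z = 0` and `⟨z, β⟩ = 0`). [folklore] -/
noncomputable def orbGamma (C : ℕ) (x₀ : ZMod S.Q) (y₀ β : Fin S.n → ZMod S.Q) (x' : ZMod S.Q)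
    (y' : Fin S.n → ZMod S.Q) : ℂ :=
  ∑ z : Fin S.n → ZMod S.Q, if (∀ t, (C : ZMod S.Q) * z t = 0) ∧ ∑ t, z t * β t = 0 then
    (ZMod.stdAddChar (∑ t, z t * y₀ t
        + 2 * ((S.p₁ : ℕ) : ZMod S.Q) * x₀ * S.sig (S.BfamT Finset.univ 0) z) : ℂ)
      * ZMod.stdAddChar (-(∑ t, z t * y' t)
        - 2 * ((S.p₁ : ℕ) : ZMod S.Q) * x' * S.sig (S.BfamT Finset.univ β) z)
    else 0

/-- The lattice count `N = #{η : A·(x′ − x₀ + ⟨η,β⟩) = 0}` of the divisor orbit. [folklore] -/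
def orbN (A : ℕ) (x₀ : ZMod S.Q) (β : Fin S.n → ZMod S.Q) (x' : ZMod S.Q) : ℕ :=
  (Finset.univ.filter fun η : Fin S.n → ZMod S.Q => (A : ZMod S.Q) * (x' - x₀ + ∑ t, η t * β t) = 0).card

/-- The constraint count `Z = #{z : C·z = 0, ⟨z,β⟩ = 0}` bounding `‖Γ‖`. [folklore] -/
def orbZ (C : ℕ) (β : Fin S.n → ZMod S.Q) : ℕ :=
  (Finset.univ.filter fun z : Fin S.n → ZMod S.Q =>
    (∀ t, (C : ZMod S.Q) * z t = 0) ∧ ∑ t, z t * β t = 0).card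

/-- **Step 1 (block form of one overlap):** `⟨O_{(r,s)}|ψ⟩ = Σ_η F_r(η)·ψ_Q(⟨η, s⟩)`.
[cite: ChenQuantumLattice2024, eq. (35) p. 31, §3.5.8 pp. 33–34] -/
theorem orbit_overlap_eq (h : S.Admissible) (x₀ : ZMod S.Q) (y₀ β : Fin S.n → ZMod S.Q) (x' : ZMod S.Q)
    (y' : Fin S.n → ZMod S.Q) (r : ZMod S.Q) (s : Fin S.n → ZMod S.Q) :
    star (S.uKet 0 (x₀ + r) (y₀ + s)) ⬝ᵥ S.uKet β x' y'
      = ∑ η : Fin S.n → ZMod S.Q, S.orbF x₀ y₀ β x' y' r η * ZMod.stdAddChar (∑ t, η t * s t) := by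
  rw [S.star_uKet_dotProduct_uKet h]
  refine Finset.sum_congr rfl fun η _ => ?_
  have hcond : S.mOf Finset.univ 0 (x₀ + r) η = S.mOf Finset.univ β x' η ↔ r = x' - x₀ + ∑ t, η t * β t := by
    rw [S.mOf_eq_mOf_iff h]
    simp only [Pi.zero_apply, mul_zero, Finset.sum_const_zero, add_zero]
    constructor
    · intro he; linear_combination he
    · intro he; linear_combination he
  unfold orbF
  rw [S.coefOf_add_tail, map_mul, ← AddChar.map_neg_eq_conj, neg_neg]
  by_cases hc : r = x' - x₀ + ∑ t, η t * β t
  · rw [if_pos (hcond.2 hc), if_pos hc]; ring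
  · rw [if_neg (fun hm => hc (hcond.1 hm)), if_neg hc, zero_mul]

/-- **Step 2 (Parseval over the tail shifts `s ∈ (C·ℤ_Q)ⁿ`):**
`Σ_{A·s=0} |⟨O_{(r,s)}|ψ⟩|² = Aⁿ·Σ_{η,η′ : C(η−η′)=0} F_r(η)·conj F_r(η′)` (`sum_ite_ann_stdAddChar_vec`).
[folklore] -/
theorem orbit_tail_normSq_sum (h : S.Admissible) {A C : ℕ} (hQ : (S.Q : ℕ) = A * C) (x₀ : ZMod S.Q)
    (y₀ β : Fin S.n → ZMod S.Q) (x' : ZMod S.Q) (y' : Fin S.n → ZMod S.Q) (r : ZMod S.Q) :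
    ∑ s : Fin S.n → ZMod S.Q, (if ∀ t, (A : ZMod S.Q) * s t = 0
        then (((‖star (S.uKet 0 (x₀ + r) (y₀ + s)) ⬝ᵥ S.uKet β x' y'‖ ^ 2 : ℝ)) : ℂ) else 0)
      = ((A : ℂ)) ^ S.n * ∑ η : Fin S.n → ZMod S.Q, ∑ η' : Fin S.n → ZMod S.Q,
          (if ∀ t, (C : ZMod S.Q) * (η t - η' t) = 0
            then S.orbF x₀ y₀ β x' y' r η * (starRingEnd ℂ) (S.orbF x₀ y₀ β x' y' r η') else 0) := by
  set F : (Fin S.n → ZMod S.Q) → ℂ := S.orbF x₀ y₀ β x' y' r with hF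
  have hsq : ∀ s : Fin S.n → ZMod S.Q,
      (((‖star (S.uKet 0 (x₀ + r) (y₀ + s)) ⬝ᵥ S.uKet β x' y'‖ ^ 2 : ℝ)) : ℂ)
        = ∑ η, ∑ η', F η * (starRingEnd ℂ) (F η') * ZMod.stdAddChar (∑ t, (η t - η' t) * s t) := by
    intro s
    rw [Complex.ofReal_pow, ← Complex.mul_conj', S.orbit_overlap_eq h, map_sum, Finset.sum_mul_sum]
    refine Finset.sum_congr rfl fun η _ => Finset.sum_congr rfl fun η' _ => ?_
    rw [map_mul, ← AddChar.map_neg_eq_conj]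
    have hlin : ∑ t, (η t - η' t) * s t = ∑ t, η t * s t + -(∑ t, η' t * s t) := by
      rw [← sub_eq_add_neg, ← Finset.sum_sub_distrib]
      exact Finset.sum_congr rfl fun t _ => by ring
    rw [hlin, AddChar.map_add_eq_mul]
    ring
  have hpull : ∀ s : Fin S.n → ZMod S.Q,
      (if ∀ t, (A : ZMod S.Q) * s t = 0
        then (((‖star (S.uKet 0 (x₀ + r) (y₀ + s)) ⬝ᵥ S.uKet β x' y'‖ ^ 2 : ℝ)) : ℂ) else 0)
      = ∑ η, ∑ η', F η * (starRingEnd ℂ) (F η')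
          * (if ∀ t, (A : ZMod S.Q) * s t = 0 then (ZMod.stdAddChar (∑ t, (η t - η' t) * s t) : ℂ) else 0) := by
    intro s
    by_cases hs : ∀ t, (A : ZMod S.Q) * s t = 0
    · simp only [if_pos hs]; exact hsq s
    · simp only [if_neg hs, mul_zero, Finset.sum_const_zero]
  simp_rw [hpull]
  rw [Finset.sum_comm]
  rw [Finset.mul_sum]
  refine Finset.sum_congr rfl fun η _ => ?_
  rw [Finset.sum_comm, Finset.mul_sum]
  refine Finset.sum_congr rfl fun η' _ => ?_
  rw [← Finset.mul_sum, sum_ite_ann_stdAddChar_vec hQ (fun t => η t - η' t)]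
  by_cases hc : ∀ t, (C : ZMod S.Q) * (η t - η' t) = 0
  · rw [if_pos hc, if_pos hc]; ring
  · rw [if_neg hc, if_neg hc, mul_zero, mul_zero]

/-- **Step 3 (block pairs collapse to the character sum `Γ`):** for `A·r = 0`,
`Σ_{η,η′ : C(η−η′)=0} F_r(η)·conj F_r(η′) = N_r·ν²·Q⁻⁴ⁿ·Γ`, `N_r = #{η : r = x′ − x₀ + ⟨η,β⟩}` — the phases
of a pair `(η, η − z)` depend on `z` only (`conj_coefOf_mul_coefOf_sub`) once `r·σ(z) = 0`
(`mul_sig_eq_zero`: `A·r = 0`, `C·z = 0`). [folklore] -/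
theorem orbit_pair_sum {A C : ℕ} (hQ : (S.Q : ℕ) = A * C) (x₀ : ZMod S.Q)
    (y₀ β : Fin S.n → ZMod S.Q) (x' : ZMod S.Q) (y' : Fin S.n → ZMod S.Q) {r : ZMod S.Q}
    (hr : (A : ZMod S.Q) * r = 0) :
    ∑ η : Fin S.n → ZMod S.Q, ∑ η' : Fin S.n → ZMod S.Q,
        (if ∀ t, (C : ZMod S.Q) * (η t - η' t) = 0
          then S.orbF x₀ y₀ β x' y' r η * (starRingEnd ℂ) (S.orbF x₀ y₀ β x' y' r η') else 0)
      = ((Finset.univ.filter fun η : Fin S.n → ZMod S.Q => r = x' - x₀ + ∑ t, η t * β t).card : ℂ)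
        * ((((S.frameNormSq : ℝ) : ℂ)) ^ 2 * ((1 / ((S.Q : ℕ) : ℂ) ^ S.n) ^ 2) ^ 2
          * S.orbGamma C x₀ y₀ β x' y') := by
  have hsumsub : ∀ η z : Fin S.n → ZMod S.Q,
      ∑ t, (η - z) t * β t = ∑ t, η t * β t - ∑ t, z t * β t := fun η z => by
    rw [← Finset.sum_sub_distrib]
    exact Finset.sum_congr rfl fun t _ => by rw [Pi.sub_apply, sub_mul]
  have hz : ∀ η : Fin S.n → ZMod S.Q,
      ∑ η' : Fin S.n → ZMod S.Q, (if ∀ t, (C : ZMod S.Q) * (η t - η' t) = 0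
          then S.orbF x₀ y₀ β x' y' r η * (starRingEnd ℂ) (S.orbF x₀ y₀ β x' y' r η') else 0)
        = if r = x' - x₀ + ∑ t, η t * β t then
            (((S.frameNormSq : ℝ) : ℂ)) ^ 2 * ((1 / ((S.Q : ℕ) : ℂ) ^ S.n) ^ 2) ^ 2
              * S.orbGamma C x₀ y₀ β x' y' else 0 := by
    intro η
    rw [← (Equiv.subLeft η).sum_comp]
    simp only [Equiv.subLeft_apply, Pi.sub_apply, sub_sub_cancel]
    by_cases hc : r = x' - x₀ + ∑ t, η t * β t
    · rw [if_pos hc, orbGamma, Finset.mul_sum]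
      refine Finset.sum_congr rfl fun z _ => ?_
      by_cases hzC : ∀ t, (C : ZMod S.Q) * z t = 0
      · rw [if_pos hzC]
        unfold orbF
        rw [if_pos hc]
        by_cases hzβ : ∑ t, z t * β t = 0
        · have hc2 : r = x' - x₀ + ∑ t, (η - z) t * β t := by rw [hsumsub, hzβ, sub_zero]; exact hc
          rw [if_pos hc2, if_pos ⟨hzC, hzβ⟩, map_mul, map_mul, Complex.conj_conj, Complex.conj_ofReal]
          have hshift : ∑ t, z t * y₀ t
              + 2 * ((S.p₁ : ℕ) : ZMod S.Q) * (x₀ + r) * S.sig (S.BfamT Finset.univ 0) z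
              = ∑ t, z t * y₀ t + 2 * ((S.p₁ : ℕ) : ZMod S.Q) * x₀ * S.sig (S.BfamT Finset.univ 0) z := by
            have h0 := S.mul_sig_eq_zero hQ (S.BfamT Finset.univ 0) hr hzC
            linear_combination (2 * ((S.p₁ : ℕ) : ZMod S.Q)) * h0
          rw [show ∀ a b c d ν : ℂ, a * (b * ν) * (c * (d * ν)) = ν ^ 2 * ((a * c) * (b * d))
              from fun _ _ _ _ _ => by ring,
            S.conj_coefOf_mul_coefOf_sub, S.coefOf_mul_conj_coefOf_sub, hshift]
          ring
        · have hc2 : ¬ (r = x' - x₀ + ∑ t, (η - z) t * β t) := by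
            rw [hsumsub]
            intro h2
            apply hzβ
            linear_combination h2 - hc
          rw [if_neg hc2, if_neg (fun h2 => hzβ h2.2), map_zero, mul_zero, mul_zero]
      · rw [if_neg hzC, if_neg (fun h2 => hzC h2.1), mul_zero]
    · rw [if_neg hc]
      refine Finset.sum_eq_zero fun z _ => ?_
      unfold orbF
      rw [if_neg hc, zero_mul, ite_self]
  simp_rw [hz]
  rw [← Finset.sum_filter, Finset.sum_const, nsmul_eq_mul]

/-- **Step 4 (the head count):** `Σ_{A·r=0} N_r = N = #{η : A·(x′ − x₀ + ⟨η,β⟩) = 0}`. [folklore] -/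
theorem orbit_count_sum (A : ℕ) (x₀ : ZMod S.Q) (β : Fin S.n → ZMod S.Q) (x' : ZMod S.Q) :
    ∑ r ∈ Finset.univ.filter (fun r : ZMod S.Q => (A : ZMod S.Q) * r = 0),
        (Finset.univ.filter fun η : Fin S.n → ZMod S.Q => r = x' - x₀ + ∑ t, η t * β t).card
      = S.orbN A x₀ β x' := by
  unfold orbN
  simp_rw [Finset.card_filter]
  rw [Finset.sum_comm]
  refine Finset.sum_congr rfl fun η _ => ?_
  rw [Finset.sum_ite_eq']
  simp only [Finset.mem_filter, Finset.mem_univ, true_and]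

/-- **THE WEIGHT IDENTITY of the divisor orbit:** `Σ_j |⟨O_j|ψ⟩|² = Aⁿ·ν²·Q⁻⁴ⁿ·N·Γ` for the member
`ψ = (β; x′, ȳ′)` of the class of the base shape. [cite: ChenQuantumLattice2024, eq. (35) p. 31, §3.5.8 pp. 33–34] -/
theorem divisorOrbit_normSq_sum (h : S.Admissible) {A C : ℕ} (hQ : (S.Q : ℕ) = A * C) (x₀ : ZMod S.Q)
    (y₀ β : Fin S.n → ZMod S.Q) (x' : ZMod S.Q) (y' : Fin S.n → ZMod S.Q) :
    ∑ j : S.OrbitIdx A, (((‖star (S.orbitVec A x₀ y₀ j) ⬝ᵥ S.uKet β x' y'‖ ^ 2 : ℝ)) : ℂ)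
      = ((A : ℂ)) ^ S.n * ((((S.frameNormSq : ℝ) : ℂ)) ^ 2 * ((1 / ((S.Q : ℕ) : ℂ) ^ S.n) ^ 2) ^ 2)
        * (S.orbN A x₀ β x' : ℂ) * S.orbGamma C x₀ y₀ β x' y' := by
  classical
  -- the subtype sum as a filtered sum over `ℤ_Q × ℤ_Qⁿ`
  have hmem : ∀ p : ZMod S.Q × (Fin S.n → ZMod S.Q),
      p ∈ Finset.univ.filter (fun p : ZMod S.Q × (Fin S.n → ZMod S.Q) =>
        (A : ZMod S.Q) * p.1 = 0 ∧ ∀ t, (A : ZMod S.Q) * p.2 t = 0)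
      ↔ (A : ZMod S.Q) * p.1 = 0 ∧ ∀ t, (A : ZMod S.Q) * p.2 t = 0 := fun p => by
    simp only [Finset.mem_filter, Finset.mem_univ, true_and]
  have hsub := Finset.sum_subtype (F := inferInstance) _ hmem
    (fun p : ZMod S.Q × (Fin S.n → ZMod S.Q) =>
      (((‖star (S.uKet 0 (x₀ + p.1) (y₀ + p.2)) ⬝ᵥ S.uKet β x' y'‖ ^ 2 : ℝ)) : ℂ))
  unfold orbitVec
  rw [← hsub, Finset.sum_filter, Fintype.sum_prod_type]
  -- separate the two indicators
  have hsep : ∀ r : ZMod S.Q,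
      ∑ s : Fin S.n → ZMod S.Q, (if (A : ZMod S.Q) * (r, s).1 = 0 ∧ ∀ t, (A : ZMod S.Q) * (r, s).2 t = 0
        then (((‖star (S.uKet 0 (x₀ + (r, s).1) (y₀ + (r, s).2)) ⬝ᵥ S.uKet β x' y'‖ ^ 2 : ℝ)) : ℂ) else 0)
      = if (A : ZMod S.Q) * r = 0 then ((A : ℂ)) ^ S.n * ∑ η : Fin S.n → ZMod S.Q, ∑ η' : Fin S.n → ZMod S.Q,
          (if ∀ t, (C : ZMod S.Q) * (η t - η' t) = 0
            then S.orbF x₀ y₀ β x' y' r η * (starRingEnd ℂ) (S.orbF x₀ y₀ β x' y' r η') else 0) else 0 := by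
    intro r
    rw [← S.orbit_tail_normSq_sum h hQ]
    by_cases hr : (A : ZMod S.Q) * r = 0
    · simp only [hr, true_and, if_true]
    · simp only [hr, false_and, if_false, Finset.sum_const_zero]
  simp_rw [hsep]
  rw [← Finset.sum_filter]
  have hpair : ∀ r ∈ Finset.univ.filter (fun r : ZMod S.Q => (A : ZMod S.Q) * r = 0),
      ((A : ℂ)) ^ S.n * ∑ η : Fin S.n → ZMod S.Q, ∑ η' : Fin S.n → ZMod S.Q,
          (if ∀ t, (C : ZMod S.Q) * (η t - η' t) = 0
            then S.orbF x₀ y₀ β x' y' r η * (starRingEnd ℂ) (S.orbF x₀ y₀ β x' y' r η') else 0)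
        = ((A : ℂ)) ^ S.n
          * (((Finset.univ.filter fun η : Fin S.n → ZMod S.Q => r = x' - x₀ + ∑ t, η t * β t).card : ℂ)
            * ((((S.frameNormSq : ℝ) : ℂ)) ^ 2 * ((1 / ((S.Q : ℕ) : ℂ) ^ S.n) ^ 2) ^ 2
              * S.orbGamma C x₀ y₀ β x' y')) := fun r hr => by
    rw [S.orbit_pair_sum hQ x₀ y₀ β x' y' (Finset.mem_filter.1 hr).2]
  rw [Finset.sum_congr rfl hpair]
  have hN := congrArg (fun m : ℕ => (m : ℂ)) (S.orbit_count_sum A x₀ β x')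
  simp only [Nat.cast_sum] at hN
  rw [← hN, Finset.mul_sum, Finset.sum_mul]
  refine Finset.sum_congr rfl fun r _ => ?_
  ring

/-! ## Part VI.  The dichotomy: weight `0/1`, or at most `1/minFac(C)²` -/

/-- `⟨η, β⟩` after updating one coordinate. [folklore] -/
theorem sum_update_mul (z : Fin S.n → ZMod S.Q) (t₀ : Fin S.n) (e : ZMod S.Q) (γ : Fin S.n → ZMod S.Q) :
    ∑ t, Function.update z t₀ e t * γ t = e * γ t₀ + ∑ t ∈ Finset.univ.erase t₀, z t * γ t := by
  rw [← Finset.add_sum_erase _ _ (Finset.mem_univ t₀), Function.update_self]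
  congr 1
  exact Finset.sum_congr rfl fun t ht => by rw [Function.update_of_ne (Finset.ne_of_mem_erase ht)]

/-- **Count bound for `N`:** if `A·β_{t₀} ≠ 0` then `Q·N ≤ Qⁿ·A·(C/minFac C)`. [folklore] -/
theorem Q_mul_orbN_le {A C : ℕ} (hQ : (S.Q : ℕ) = A * C) {β : Fin S.n → ZMod S.Q} (t₀ : Fin S.n)
    (hβ : (A : ZMod S.Q) * β t₀ ≠ 0) (x₀ x' : ZMod S.Q) :
    (S.Q : ℕ) * S.orbN A x₀ β x' ≤ (S.Q : ℕ) ^ S.n * (A * (C / C.minFac)) := by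
  classical
  have hcardQ : (Finset.univ.filter fun _ : ZMod S.Q => True).card = (S.Q : ℕ) := by
    rw [Finset.filter_true_of_mem fun _ _ => trivial, Finset.card_univ, ZMod.card]
  have hCγ : (C : ZMod S.Q) * ((A : ZMod S.Q) * β t₀) = 0 := by
    rw [← mul_assoc, mul_comm (C : ZMod S.Q), natCast_mul_natCast_eq_zero hQ, zero_mul]
  have hB : ∀ z : Fin S.n → ZMod S.Q, (∀ t : Fin S.n, True) →
      (Finset.univ.filter fun e : ZMod S.Q =>
        (A : ZMod S.Q) * (x' - x₀ + ∑ t, Function.update z t₀ e t * β t) = 0).card ≤ A * (C / C.minFac) := by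
    intro z _
    set c₀ : ZMod S.Q := (A : ZMod S.Q) * (x' - x₀ + ∑ t ∈ Finset.univ.erase t₀, z t * β t) with hc₀
    calc (Finset.univ.filter fun e : ZMod S.Q =>
            (A : ZMod S.Q) * (x' - x₀ + ∑ t, Function.update z t₀ e t * β t) = 0).card
        = (Finset.univ.filter fun e : ZMod S.Q =>
            (0 : ZMod S.Q) * e = 0 ∧ (A : ZMod S.Q) * β t₀ * e + c₀ = 0).card := by
          congr 1
          ext e
          simp only [Finset.mem_filter, Finset.mem_univ, true_and, zero_mul, S.sum_update_mul]
          constructor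
          · intro he; linear_combination he
          · intro he; linear_combination he
      _ ≤ (Finset.univ.filter fun e : ZMod S.Q =>
            (0 : ZMod S.Q) * e = 0 ∧ (A : ZMod S.Q) * β t₀ * e = 0).card := card_filter_affine_le 0 _ c₀ 0
      _ = (Finset.univ.filter fun e : ZMod S.Q => (A : ZMod S.Q) * β t₀ * e = 0).card := by
          congr 1
          ext e
          simp only [Finset.mem_filter, Finset.mem_univ, true_and, zero_mul]
      _ ≤ A * (C / C.minFac) := card_filter_mul_eq_zero_le hQ hβ hCγ
  have key := card_mul_card_filter_le t₀
    (fun η : Fin S.n → ZMod S.Q => (A : ZMod S.Q) * (x' - x₀ + ∑ t, η t * β t) = 0)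
    (fun _ : ZMod S.Q => True) (fun _ _ _ => trivial) (A * (C / C.minFac)) hB
  rw [hcardQ] at key
  exact key

/-- **Count bound for `Z`:** if `A·β_{t₀} ≠ 0` then `C·Z ≤ Cⁿ·(C/minFac C)`. [folklore] -/
theorem C_mul_orbZ_le {A C : ℕ} (hQ : (S.Q : ℕ) = A * C) {β : Fin S.n → ZMod S.Q} (t₀ : Fin S.n)
    (hβ : (A : ZMod S.Q) * β t₀ ≠ 0) : C * S.orbZ C β ≤ C ^ S.n * (C / C.minFac) := by
  classical
  have hQ' : (S.Q : ℕ) = C * A := by rw [hQ, mul_comm]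
  have hcardC : (Finset.univ.filter fun a : ZMod S.Q => (C : ZMod S.Q) * a = 0).card = C :=
    card_filter_ann hQ'
  have hB : ∀ z : Fin S.n → ZMod S.Q, (∀ t, (C : ZMod S.Q) * z t = 0) →
      (Finset.univ.filter fun e : ZMod S.Q =>
        (∀ t, (C : ZMod S.Q) * Function.update z t₀ e t = 0)
          ∧ ∑ t, Function.update z t₀ e t * β t = 0).card ≤ C / C.minFac := by
    intro z _
    set R₀ : ZMod S.Q := ∑ t ∈ Finset.univ.erase t₀, z t * β t with hR₀
    calc (Finset.univ.filter fun e : ZMod S.Q =>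
            (∀ t, (C : ZMod S.Q) * Function.update z t₀ e t = 0)
              ∧ ∑ t, Function.update z t₀ e t * β t = 0).card
        ≤ (Finset.univ.filter fun e : ZMod S.Q => (C : ZMod S.Q) * e = 0 ∧ β t₀ * e + R₀ = 0).card := by
          refine Finset.card_le_card fun e he => ?_
          simp only [Finset.mem_filter, Finset.mem_univ, true_and] at he ⊢
          refine ⟨?_, ?_⟩
          · have h1 := he.1 t₀
            rwa [Function.update_self] at h1
          · have h2 := he.2
            rw [S.sum_update_mul] at h2
            linear_combination h2
      _ ≤ (Finset.univ.filter fun e : ZMod S.Q => (C : ZMod S.Q) * e = 0 ∧ β t₀ * e = 0).card :=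
          card_filter_affine_le (C : ZMod S.Q) (β t₀) R₀ 0
      _ ≤ C / C.minFac := card_filter_ann_inf_le hQ hβ
  have key := card_mul_card_filter_le t₀
    (fun z : Fin S.n → ZMod S.Q => (∀ t, (C : ZMod S.Q) * z t = 0) ∧ ∑ t, z t * β t = 0)
    (fun a : ZMod S.Q => (C : ZMod S.Q) * a = 0) (fun _ hz => hz.1) (C / C.minFac) hB
  rw [hcardC] at key
  exact key

/-- `‖Γ‖ ≤ Z`. [folklore] -/
theorem norm_orbGamma_le (C : ℕ) (x₀ : ZMod S.Q) (y₀ β : Fin S.n → ZMod S.Q) (x' : ZMod S.Q)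
    (y' : Fin S.n → ZMod S.Q) : ‖S.orbGamma C x₀ y₀ β x' y'‖ ≤ (S.orbZ C β : ℝ) := by
  unfold orbGamma orbZ
  refine (norm_sum_le _ _).trans ?_
  rw [Finset.card_filter, Nat.cast_sum]
  refine Finset.sum_le_sum fun z _ => ?_
  split_ifs with hc
  · rw [norm_mul, S.norm_stdAddChar_eq_one, S.norm_stdAddChar_eq_one, mul_one, Nat.cast_one]
  · rw [norm_zero, Nat.cast_zero]

/-- **The decisive inequality (case `A·β ≠ 0`):** `Aⁿ·N·Z·minFac(C)² ≤ Q²ⁿ` — each of the two counts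
is a PROPER subgroup count and loses a factor `minFac(C)`. [folklore] -/
theorem orbN_orbZ_bound {A C : ℕ} (hQ : (S.Q : ℕ) = A * C) {β : Fin S.n → ZMod S.Q} (t₀ : Fin S.n)
    (hβ : (A : ZMod S.Q) * β t₀ ≠ 0) (x₀ x' : ZMod S.Q) :
    (A : ℝ) ^ S.n * S.orbN A x₀ β x' * S.orbZ C β * (C.minFac : ℝ) ^ 2 ≤ ((S.Q : ℕ) : ℝ) ^ (2 * S.n) := by
  obtain ⟨m, hm⟩ := Nat.exists_eq_succ_of_ne_zero (Nat.pos_iff_ne_zero.1 (Fin.pos t₀))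
  have hN := S.Q_mul_orbN_le hQ t₀ hβ x₀ x'
  have hZ := S.C_mul_orbZ_le hQ t₀ hβ
  have hQpos : 0 < (S.Q : ℕ) := S.Q.pos
  have hCpos : 0 < C := pos_right_of_eq_mul hQ
  set d : ℕ := C / C.minFac with hd
  set p : ℕ := C.minFac with hp
  have hdC : p * d = C := Nat.mul_div_cancel' (Nat.minFac_dvd C)
  rw [hm] at hN hZ ⊢
  have hN' : S.orbN A x₀ β x' ≤ (S.Q : ℕ) ^ m * (A * d) := by
    refine Nat.le_of_mul_le_mul_left ?_ hQpos
    calc (S.Q : ℕ) * S.orbN A x₀ β x' ≤ (S.Q : ℕ) ^ (m + 1) * (A * d) := hN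
      _ = (S.Q : ℕ) * ((S.Q : ℕ) ^ m * (A * d)) := by ring
  have hZ' : S.orbZ C β ≤ C ^ m * d := by
    refine Nat.le_of_mul_le_mul_left ?_ hCpos
    calc C * S.orbZ C β ≤ C ^ (m + 1) * d := hZ
      _ = C * (C ^ m * d) := by ring
  have hnat : A ^ (m + 1) * S.orbN A x₀ β x' * S.orbZ C β * p ^ 2 ≤ (S.Q : ℕ) ^ (2 * (m + 1)) := by
    calc A ^ (m + 1) * S.orbN A x₀ β x' * S.orbZ C β * p ^ 2
        ≤ A ^ (m + 1) * ((S.Q : ℕ) ^ m * (A * d)) * (C ^ m * d) * p ^ 2 := by gcongr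
      _ = (S.Q : ℕ) ^ (2 * (m + 1)) := by
          rw [hQ, ← hdC]
          ring
  exact_mod_cast hnat

/-- **Case `A·β = 0` on the tail: both factors are full.**  `N = Qⁿ·[A(x′−x₀) = 0]` and
`Γ = Cⁿ·[A·κ = 0]`, `κ_t = ȳ₀_t − ȳ′_t + 2p₁(x₀ − x′)·(b_{t+1}/(2p₁))`. [folklore] -/
theorem orbN_orbGamma_of_ann {A C : ℕ} (hQ : (S.Q : ℕ) = A * C) (x₀ : ZMod S.Q)
    (y₀ : Fin S.n → ZMod S.Q) {β : Fin S.n → ZMod S.Q} (hβ : ∀ t, (A : ZMod S.Q) * β t = 0)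
    (x' : ZMod S.Q) (y' : Fin S.n → ZMod S.Q) :
    ((S.orbN A x₀ β x' : ℂ) = if (A : ZMod S.Q) * (x' - x₀) = 0 then ((S.Q : ℕ) : ℂ) ^ S.n else 0)
    ∧ (S.orbGamma C x₀ y₀ β x' y'
        = if ∀ t, (A : ZMod S.Q) * (y₀ t - y' t + 2 * ((S.p₁ : ℕ) : ZMod S.Q) * (x₀ - x')
            * ((S.b t.succ / (2 * (S.p₁ : ℤ)) : ℤ) : ZMod S.Q)) = 0 then ((C : ℂ)) ^ S.n else 0) := by
  classical
  have hQ' : (S.Q : ℕ) = C * A := by rw [hQ, mul_comm]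
  refine ⟨?_, ?_⟩
  · -- `N`
    have hconst : ∀ η : Fin S.n → ZMod S.Q,
        (A : ZMod S.Q) * (x' - x₀ + ∑ t, η t * β t) = (A : ZMod S.Q) * (x' - x₀) := by
      intro η
      rw [mul_add, Finset.mul_sum, Finset.sum_eq_zero fun t _ => ?_, add_zero]
      rw [mul_left_comm, hβ t, mul_zero]
    unfold orbN
    by_cases hc : (A : ZMod S.Q) * (x' - x₀) = 0
    · rw [if_pos hc, Finset.filter_true_of_mem fun η _ => (hconst η).trans hc, Finset.card_univ,
        Fintype.card_fun, ZMod.card, Fintype.card_fin]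
      push_cast
      ring
    · rw [if_neg hc, Finset.filter_false_of_mem fun η _ => fun he => hc ((hconst η).symm.trans he),
        Finset.card_empty, Nat.cast_zero]
  · -- `Γ`
    unfold orbGamma
    have hterm : ∀ z : Fin S.n → ZMod S.Q,
        (if (∀ t, (C : ZMod S.Q) * z t = 0) ∧ ∑ t, z t * β t = 0 then
          (ZMod.stdAddChar (∑ t, z t * y₀ t
              + 2 * ((S.p₁ : ℕ) : ZMod S.Q) * x₀ * S.sig (S.BfamT Finset.univ 0) z) : ℂ)
            * ZMod.stdAddChar (-(∑ t, z t * y' t)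
              - 2 * ((S.p₁ : ℕ) : ZMod S.Q) * x' * S.sig (S.BfamT Finset.univ β) z)
          else 0)
        = if ∀ t, (C : ZMod S.Q) * z t = 0 then
            (ZMod.stdAddChar (∑ t, (y₀ t - y' t + 2 * ((S.p₁ : ℕ) : ZMod S.Q) * (x₀ - x')
              * ((S.b t.succ / (2 * (S.p₁ : ℤ)) : ℤ) : ZMod S.Q)) * z t) : ℂ) else 0 := by
      intro z
      by_cases hzC : ∀ t, (C : ZMod S.Q) * z t = 0
      · have hzβ : ∑ t, z t * β t = 0 := Finset.sum_eq_zero fun t _ => by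
          rw [mul_comm]; exact mul_eq_zero_of_ann hQ (hβ t) (hzC t)
        have hlin : ∑ t, (y₀ t - y' t + 2 * ((S.p₁ : ℕ) : ZMod S.Q) * (x₀ - x')
              * ((S.b t.succ / (2 * (S.p₁ : ℤ)) : ℤ) : ZMod S.Q)) * z t
            = ∑ t, z t * y₀ t - ∑ t, z t * y' t + 2 * ((S.p₁ : ℕ) : ZMod S.Q) * (x₀ - x')
              * ∑ t, z t * ((S.b t.succ / (2 * (S.p₁ : ℤ)) : ℤ) : ZMod S.Q) := by
          rw [Finset.mul_sum, ← Finset.sum_sub_distrib, ← Finset.sum_add_distrib]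
          exact Finset.sum_congr rfl fun t _ => by ring
        rw [if_pos ⟨hzC, hzβ⟩, if_pos hzC, ← AddChar.map_add_eq_mul, S.sig_BfamT, S.sig_BfamT, hzβ, hlin]
        congr 1
        simp only [Pi.zero_apply, mul_zero, Finset.sum_const_zero, add_zero, sig]
        ring
      · rw [if_neg (fun h2 => hzC h2.1), if_neg hzC]
    simp_rw [hterm]
    rw [sum_ite_ann_stdAddChar_vec hQ']

end Shape

/-! ## Part VII.  Almost-certain outcomes of a binary frame measurement -/

namespace POVM

section FrameBinaryOutcomes

variable {X ι : Type*} [Fintype X] [DecidableEq X] [Fintype ι] [DecidableEq ι]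

/-- If the frame weights of `φ` exhaust `⟨φ|φ⟩` (i.e. `φ` lies in the span of the frame) then outcome `0`
of the binary frame measurement is `ε`-almost certain for every `ε ≥ 0`.
[cite: NielsenChuang2010, §2.2.6 p. 90] -/
theorem ofFrameBinary_almostCertain_zero (w : ι → X → ℂ) {ν : ℝ} (hν : 0 < ν)
    (horth : ∀ j k, star (w j) ⬝ᵥ w k = if j = k then ((ν : ℝ) : ℂ) else 0) (φ : X → ℂ) {ε : ℝ}
    (hε : 0 ≤ ε) (hW : ∑ j, ν⁻¹ * ‖star (w j) ⬝ᵥ φ‖ ^ 2 = (star φ ⬝ᵥ φ).re) :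
    (ofFrameBinary w hν horth).AlmostCertain ε φ 0 := by
  unfold AlmostCertain
  rw [ofFrameBinary_weight_zero, Complex.ofReal_re, hW]
  have h0 : 0 ≤ (star φ ⬝ᵥ φ).re := star_dotProduct_self_re_nonneg φ
  nlinarith

/-- If the frame weights of `φ` total at most `ε⟨φ|φ⟩` then outcome `1` of the binary frame measurement is
`ε`-almost certain. [cite: NielsenChuang2010, §2.2.6 p. 90] -/
theorem ofFrameBinary_almostCertain_one (w : ι → X → ℂ) {ν : ℝ} (hν : 0 < ν)
    (horth : ∀ j k, star (w j) ⬝ᵥ w k = if j = k then ((ν : ℝ) : ℂ) else 0) (φ : X → ℂ) {ε : ℝ}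
    (hW : ∑ j, ν⁻¹ * ‖star (w j) ⬝ᵥ φ‖ ^ 2 ≤ ε * (star φ ⬝ᵥ φ).re) :
    (ofFrameBinary w hν horth).AlmostCertain ε φ 1 := by
  unfold AlmostCertain
  rw [ofFrameBinary_weight_one_re]
  linarith

omit [DecidableEq X] in
/-- A frame member has full frame weight: `Σ_j ν⁻¹‖⟨w_j|w_{j₀}⟩‖² = ν = ⟨w_{j₀}|w_{j₀}⟩`. [folklore] -/
theorem frame_weight_self (w : ι → X → ℂ) {ν : ℝ} (hν : 0 < ν)
    (horth : ∀ j k, star (w j) ⬝ᵥ w k = if j = k then ((ν : ℝ) : ℂ) else 0) (j₀ : ι) :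
    ∑ j, ν⁻¹ * ‖star (w j) ⬝ᵥ w j₀‖ ^ 2 = (star (w j₀) ⬝ᵥ w j₀).re := by
  have h : ∀ j, ν⁻¹ * ‖star (w j) ⬝ᵥ w j₀‖ ^ 2 = if j = j₀ then ν else 0 := by
    intro j
    rw [horth j j₀]
    split_ifs with hj
    · rw [Complex.norm_real, Real.norm_eq_abs, abs_of_pos hν, sq, ← mul_assoc, inv_mul_cancel₀ hν.ne',
        one_mul]
    · rw [norm_zero]; ring
  simp_rw [h]
  rw [Finset.sum_ite_eq', if_pos (Finset.mem_univ _), horth j₀ j₀, if_pos rfl, Complex.ofReal_re]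

/-- Outcome `0` is `ε`-almost certain (every `ε ≥ 0`) on each frame MEMBER. [cite: NielsenChuang2010, §2.2.6 p. 90] -/
theorem ofFrameBinary_almostCertain_zero_self (w : ι → X → ℂ) {ν : ℝ} (hν : 0 < ν)
    (horth : ∀ j k, star (w j) ⬝ᵥ w k = if j = k then ((ν : ℝ) : ℂ) else 0) (j₀ : ι) {ε : ℝ}
    (hε : 0 ≤ ε) : (ofFrameBinary w hν horth).AlmostCertain ε (w j₀) 0 :=
  ofFrameBinary_almostCertain_zero w hν horth (w j₀) hε (frame_weight_self w hν horth j₀)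

/-- Outcome `1` is `ε`-almost certain (every `ε ≥ 0`) on each vector ORTHOGONAL to the frame.
[cite: NielsenChuang2010, §2.2.6 p. 90] -/
theorem ofFrameBinary_almostCertain_one_of_orthogonal (w : ι → X → ℂ) {ν : ℝ} (hν : 0 < ν)
    (horth : ∀ j k, star (w j) ⬝ᵥ w k = if j = k then ((ν : ℝ) : ℂ) else 0) (φ : X → ℂ) {ε : ℝ}
    (hε : 0 ≤ ε) (h0 : ∀ j, star (w j) ⬝ᵥ φ = 0) :
    (ofFrameBinary w hν horth).AlmostCertain ε φ 1 := by
  refine ofFrameBinary_almostCertain_one w hν horth φ ?_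
  have hz : ∀ j, ν⁻¹ * ‖star (w j) ⬝ᵥ φ‖ ^ 2 = 0 := fun j => by rw [h0 j, norm_zero]; ring
  simp_rw [hz, Finset.sum_const_zero]
  exact mul_nonneg hε (star_dotProduct_self_re_nonneg φ)

end FrameBinaryOutcomes

end POVM

/-! ## Part VIII.  The dichotomy: every class member receives an almost-certain outcome at `1/minFac(C)²` -/

namespace Shape

variable (S : Shape)

/-- `⟨u|u⟩ = ν/Qⁿ` for a member. [folklore] -/
theorem star_uKet_self (h : S.Admissible) (β : Fin S.n → ZMod S.Q) (x : ZMod S.Q)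
    (yb : Fin S.n → ZMod S.Q) :
    star (S.uKet β x yb) ⬝ᵥ S.uKet β x yb = (((S.frameNormSq / ((S.Q : ℕ) : ℝ) ^ S.n : ℝ)) : ℂ) := by
  rw [S.star_uKet_dotProduct_uKet_same h, if_pos ⟨rfl, rfl⟩]

/-- **THE DICHOTOMY.**  For `Q = A·C`, `C > 1`, the divisor-orbit measurement based at any `(x₀, ȳ₀)` gives
EVERY member `(β; x′, ȳ′)` of the shape's class an almost-certain outcome at tolerance `1/minFac(C)²`:
outcome `0` when `A·β = 0`, `A(x′ − x₀) = 0` and `A·κ = 0` (then the member lies IN the orbit span),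
outcome `1` otherwise (weight of the orbit span `= 0` in the remaining `A·β = 0` cases, `≤ ⟨u|u⟩/minFac(C)²`
when `A·β ≠ 0`, by `divisorOrbit_normSq_sum` and `orbN_orbZ_bound`).
[cite: ChenQuantumLattice2024, §3.1 p. 22 ("Q = p₂⋯p_κ"), Cond. C.3 p. 18, eq. (35) p. 31;
NielsenChuang2010, §2.2.6 p. 90] -/
theorem divisorOrbit_almostCertain (h : S.Admissible) {A C : ℕ} (hQ : (S.Q : ℕ) = A * C) (hC : 1 < C)
    (x₀ : ZMod S.Q) (y₀ : Fin S.n → ZMod S.Q) (β : Fin S.n → ZMod S.Q) (x' : ZMod S.Q)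
    (y' : Fin S.n → ZMod S.Q) :
    ∃ k, (S.orbitPOVM h A x₀ y₀).AlmostCertain (1 / (C.minFac : ℝ) ^ 2) (S.uKet β x' y') k := by
  classical
  have hν : 0 < S.frameNormSq := S.frameNormSq_pos
  have hq : (0 : ℝ) < ((S.Q : ℕ) : ℝ) := by exact_mod_cast S.Q.pos
  have hνO : 0 < S.frameNormSq / ((S.Q : ℕ) : ℝ) ^ S.n := S.frameNormSq_div_pos
  have hmF : (0 : ℝ) < (C.minFac : ℝ) := by exact_mod_cast Nat.minFac_pos C
  have hε : (0 : ℝ) ≤ 1 / (C.minFac : ℝ) ^ 2 := by positivity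
  have hself : (star (S.uKet β x' y') ⬝ᵥ S.uKet β x' y').re = S.frameNormSq / ((S.Q : ℕ) : ℝ) ^ S.n := by
    rw [S.star_uKet_self h, Complex.ofReal_re]
  -- the total frame weight `W` and its closed form
  set W : ℝ := ∑ j : S.OrbitIdx A, ‖star (S.orbitVec A x₀ y₀ j) ⬝ᵥ S.uKet β x' y'‖ ^ 2 with hWdef
  have hW0 : 0 ≤ W := Finset.sum_nonneg fun j _ => by positivity
  have hWC : ((W : ℝ) : ℂ) = ((A : ℂ)) ^ S.n
      * ((((S.frameNormSq : ℝ) : ℂ)) ^ 2 * ((1 / ((S.Q : ℕ) : ℂ) ^ S.n) ^ 2) ^ 2)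
      * (S.orbN A x₀ β x' : ℂ) * S.orbGamma C x₀ y₀ β x' y' := by
    rw [hWdef, Complex.ofReal_sum]
    exact S.divisorOrbit_normSq_sum h hQ x₀ y₀ β x' y'
  have hsumW : ∑ j : S.OrbitIdx A, (S.frameNormSq / ((S.Q : ℕ) : ℝ) ^ S.n)⁻¹
        * ‖star (S.orbitVec A x₀ y₀ j) ⬝ᵥ S.uKet β x' y'‖ ^ 2
      = (S.frameNormSq / ((S.Q : ℕ) : ℝ) ^ S.n)⁻¹ * W := by
    rw [hWdef, Finset.mul_sum]
  have hAC : ((A : ℂ)) * (C : ℂ) = ((S.Q : ℕ) : ℂ) := by exact_mod_cast hQ.symm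
  have hQC : ((S.Q : ℕ) : ℂ) ≠ 0 := by exact_mod_cast S.Q.ne_zero
  by_cases hβ : ∀ t, (A : ZMod S.Q) * β t = 0
  · -- case (i): `A·β = 0`
    obtain ⟨hN, hΓ⟩ := S.orbN_orbGamma_of_ann hQ x₀ y₀ hβ x' y'
    by_cases hfull : (A : ZMod S.Q) * (x' - x₀) = 0 ∧
        ∀ t, (A : ZMod S.Q) * (y₀ t - y' t + 2 * ((S.p₁ : ℕ) : ZMod S.Q) * (x₀ - x')
          * ((S.b t.succ / (2 * (S.p₁ : ℤ)) : ℤ) : ZMod S.Q)) = 0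
    · -- the member lies in the orbit span: outcome 0
      rw [if_pos hfull.1] at hN
      rw [if_pos hfull.2] at hΓ
      have hWval : W = (S.frameNormSq / ((S.Q : ℕ) : ℝ) ^ S.n) ^ 2 := by
        have hC' : ((W : ℝ) : ℂ) = ((((S.frameNormSq / ((S.Q : ℕ) : ℝ) ^ S.n) ^ 2 : ℝ)) : ℂ) := by
          rw [hWC, hN, hΓ]
          push_cast
          rw [← hAC]
          have hA0 : ((A : ℂ)) ≠ 0 := by
            intro h0; rw [h0, zero_mul] at hAC; exact hQC hAC.symm
          have hC0 : ((C : ℂ)) ≠ 0 := by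
            intro h0; rw [h0, mul_zero] at hAC; exact hQC hAC.symm
          field_simp
          ring
        exact_mod_cast hC'
      refine ⟨0, POVM.ofFrameBinary_almostCertain_zero _ _ _ _ hε ?_⟩
      rw [hsumW, hWval, hself]
      field_simp
    · -- orthogonal to the orbit span: outcome 1
      have hWval : W = 0 := by
        have hC' : ((W : ℝ) : ℂ) = 0 := by
          rw [hWC]
          rcases not_and_or.1 hfull with h1 | h1
          · rw [if_neg h1] at hN
            rw [hN]; ring
          · rw [if_neg h1] at hΓ
            rw [hΓ]; ring
        exact_mod_cast hC'
      refine ⟨1, POVM.ofFrameBinary_almostCertain_one _ _ _ _ ?_⟩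
      rw [hsumW, hWval, mul_zero, hself]
      positivity
  · -- case (ii): `A·β_{t₀} ≠ 0`
    push Not at hβ
    obtain ⟨t₀, ht₀⟩ := hβ
    have hbound := S.orbN_orbZ_bound hQ t₀ ht₀ x₀ x'
    have hΓ := S.norm_orbGamma_le C x₀ y₀ β x' y'
    have hWle : W ≤ (S.frameNormSq / ((S.Q : ℕ) : ℝ) ^ S.n) ^ 2 / (C.minFac : ℝ) ^ 2 := by
      have hWnorm : W = ‖((W : ℝ) : ℂ)‖ := by
        rw [Complex.norm_real, Real.norm_eq_abs, abs_of_nonneg hW0]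
      rw [hWnorm, hWC]
      simp only [norm_mul, norm_pow, Complex.norm_natCast, Complex.norm_real, norm_div, norm_one,
        Real.norm_eq_abs, abs_of_pos hν]
      calc ((A : ℝ)) ^ S.n * (S.frameNormSq ^ 2 * ((1 / ((S.Q : ℕ) : ℝ) ^ S.n) ^ 2) ^ 2)
              * (S.orbN A x₀ β x' : ℝ) * ‖S.orbGamma C x₀ y₀ β x' y'‖
          ≤ ((A : ℝ)) ^ S.n * (S.frameNormSq ^ 2 * ((1 / ((S.Q : ℕ) : ℝ) ^ S.n) ^ 2) ^ 2)
              * (S.orbN A x₀ β x' : ℝ) * (S.orbZ C β : ℝ) := by gcongr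
        _ = (S.frameNormSq ^ 2 * ((1 / ((S.Q : ℕ) : ℝ) ^ S.n) ^ 2) ^ 2)
              * (((A : ℝ)) ^ S.n * (S.orbN A x₀ β x' : ℝ) * (S.orbZ C β : ℝ)) := by ring
        _ ≤ (S.frameNormSq ^ 2 * ((1 / ((S.Q : ℕ) : ℝ) ^ S.n) ^ 2) ^ 2)
              * (((S.Q : ℕ) : ℝ) ^ (2 * S.n) / (C.minFac : ℝ) ^ 2) := by
            gcongr
            rw [le_div_iff₀ (by positivity)]
            exact hbound
        _ = (S.frameNormSq / ((S.Q : ℕ) : ℝ) ^ S.n) ^ 2 / (C.minFac : ℝ) ^ 2 := by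
            field_simp
            ring
    refine ⟨1, POVM.ofFrameBinary_almostCertain_one _ _ _ _ ?_⟩
    rw [hsumW, hself]
    calc (S.frameNormSq / ((S.Q : ℕ) : ℝ) ^ S.n)⁻¹ * W
        ≤ (S.frameNormSq / ((S.Q : ℕ) : ℝ) ^ S.n)⁻¹
            * ((S.frameNormSq / ((S.Q : ℕ) : ℝ) ^ S.n) ^ 2 / (C.minFac : ℝ) ^ 2) := by gcongr
      _ = 1 / (C.minFac : ℝ) ^ 2 * (S.frameNormSq / ((S.Q : ℕ) : ℝ) ^ S.n) := by
            field_simp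

/-! ## Part IX.  Identification of `S` and of the shifted instance as members of the base shape's class;
orthogonality to the other cosets -/

/-- A member of the base shape of coset `c₀` is orthogonal to every member of a DIFFERENT coset class.
[folklore] -/
theorem star_uKet_dotProduct_cmember_ne (h : S.Admissible) {c₀ c : S.Coset} (hc : c₀ ≠ c)
    (β₀ : Fin S.n → ZMod S.Q) (x₁ : ZMod S.Q) (y₁ : Fin S.n → ZMod S.Q) (β : Fin S.n → ZMod S.Q)
    (x : ZMod S.Q) (yb : Fin S.n → ZMod S.Q) :
    star ((S.cshape c₀).uKet β₀ x₁ y₁) ⬝ᵥ (S.cmember Finset.univ c β x yb).phi7d = 0 := by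
  have hφ : (S.cshape c₀).uKet β₀ x₁ y₁ = ∑ η : Fin S.n → ZMod S.Q,
      (S.cshape c₀).coefOf Finset.univ β₀ x₁ y₁ η
        • (S.cshape c₀).frameVec (η, (S.cshape c₀).mOf Finset.univ β₀ x₁ η) := by
    funext p
    rw [Finset.sum_apply]
    simp_rw [Pi.smul_apply, smul_eq_mul]
    exact (S.cshape c₀).phi7d_member_apply Finset.univ β₀ x₁ y₁ p
  rw [hφ, star_sum, sum_dotProduct]
  refine Finset.sum_eq_zero fun η _ => ?_
  have h0 : star ((S.cshape c₀).frameVec (η, (S.cshape c₀).mOf Finset.univ β₀ x₁ η))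
      ⬝ᵥ (S.cmember Finset.univ c β x yb).phi7d = 0 :=
    S.bigFrameVec_dotProduct_cmember_ne h Finset.univ β x yb hc (η, (S.cshape c₀).mOf Finset.univ β₀ x₁ η)
  rw [star_smul, smul_dotProduct, h0, smul_zero]

/-- **Shifting the offset by `L·e` moves within the base class:** `|φ7.d(b; v′ + L·e)⟩` is the member
`(β = 0; x = q₀ + e₀, ȳ_t = q_{t+1} + e_{t+1})` of the class of the base shape of `S`'s coset, where
`v′ = D·c + L·q`. [cite: ChenQuantumLattice2024, eq. (35) p. 31, §3.5.8 pp. 33–34] -/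
theorem phi7d_inst_shift_eq_uKet (h : S.Admissible) (e : Fin (S.n + 1) → ℤ) :
    (S.inst S.b (fun i => S.v' i + S.L * e i)).phi7d
      = (S.cshape (S.cosetOf S.v')).uKet 0 (((S.quotOf S.v' 0 + e 0 : ℤ)) : ZMod S.Q)
          (fun t => (((S.quotOf S.v' t.succ + e t.succ : ℤ)) : ZMod S.Q)) := by
  set c := S.cosetOf S.v' with hc
  set x : ZMod S.Q := (((S.quotOf S.v' 0 + e 0 : ℤ)) : ZMod S.Q) with hx
  set yb : Fin S.n → ZMod S.Q := fun t => (((S.quotOf S.v' t.succ + e t.succ : ℤ)) : ZMod S.Q)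
    with hyb
  -- the slopes agree modulo `P`
  have hb : ∀ i, ((S.P : ℕ) : ℤ) ∣ S.b i - (S.cshape c).famBT Finset.univ 0 i := by
    intro i
    refine Fin.cases ?_ (fun t => ?_) i
    · rw [h.b_head, famBT_zero, sub_self]; exact dvd_zero _
    · rw [(S.cshape c).famBT_succ Finset.univ 0 t]
      have hB : 2 * (S.p₁ : ℤ) * (S.b t.succ / (2 * (S.p₁ : ℤ))) = S.b t.succ :=
        Int.mul_ediv_cancel' (h.b_tail t.succ (Fin.succ_ne_zero t))
      have hBf : 2 * (((S.cshape c).p₁ : ℕ) : ℤ) * (S.cshape c).BfamT Finset.univ 0 t = S.b t.succ := by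
        show 2 * (S.p₁ : ℤ) * (S.b t.succ / (2 * (S.p₁ : ℤ))
            + (if t ∈ Finset.univ then (((0 : Fin S.n → ZMod S.Q) t).val : ℤ) else 0)) = S.b t.succ
        simp only [Finset.mem_univ, if_true, Pi.zero_apply, ZMod.val_zero, Nat.cast_zero, add_zero]
        exact hB
      rw [hBf, sub_self]; exact dvd_zero _
  -- the offsets agree modulo `M`
  have hq' : ∀ i, S.vrep c i + S.L * S.quotOf S.v' i = S.v' i := fun i =>
    S.vrep_cosetOf_add h.v'_in_DZ i
  have hr : ∀ i, ((S.cshape c).xyv x yb i : ℤ) = (S.quotOf S.v' i + e i) % ((S.Q : ℕ) : ℤ) := by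
    intro i
    refine Fin.cases ?_ (fun t => ?_) i
    · rw [xyv_zero, hx]; exact ZMod.val_intCast _
    · rw [xyv_succ, hyb]; exact ZMod.val_intCast _
  have hv : ∀ i, (((fun i => S.v' i + S.L * e i) i : ℤ) : ZMod S.M)
      = ((((S.cshape c).vOf ((S.cshape c).xyv x yb) i : ℤ)) : ZMod S.M) := by
    intro i
    rw [ZMod.intCast_eq_intCast_iff_dvd_sub, vOf_apply, S.M_eq_L_mul_Q]
    show S.L * ((S.Q : ℕ) : ℤ) ∣ S.vrep c i + S.L * ((S.cshape c).xyv x yb i : ℤ) - (S.v' i + S.L * e i)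
    rw [hr i]
    have hsq := Int.mul_ediv_add_emod (S.quotOf S.v' i + e i) ((S.Q : ℕ) : ℤ)
    exact ⟨-((S.quotOf S.v' i + e i) / ((S.Q : ℕ) : ℤ)), by linear_combination hq' i + S.L * hsq⟩
  exact (S.phi7d_inst_congr_b (fun i => S.v' i + S.L * e i) hb).trans
    (phi7d_inst_congr (S := S) ((S.cshape c).famBT Finset.univ 0)
      ((S.cshape c).vOf ((S.cshape c).xyv x yb)) (fun i => S.v' i + S.L * e i) hv)

/-- `|φ7.d⟩` of `S` itself is the member `(0; q₀, (q_{t+1})_t)` of its coset's base class.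
[cite: ChenQuantumLattice2024, eq. (35) p. 31] -/
theorem phi7d_eq_uKet (h : S.Admissible) :
    S.phi7d = (S.cshape (S.cosetOf S.v')).uKet 0 ((S.quotOf S.v' 0 : ℤ) : ZMod S.Q)
      (fun t => ((S.quotOf S.v' t.succ : ℤ) : ZMod S.Q)) := by
  have h0 := S.phi7d_inst_shift_eq_uKet h 0
  have hv : (fun i => S.v' i + S.L * (0 : Fin (S.n + 1) → ℤ) i) = S.v' := by
    funext i; simp
  rw [hv] at h0
  have hS : S.phi7d = (S.inst S.b S.v').phi7d := rfl
  refine hS.trans ?_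
  simpa using h0

/-- `|φ7.d⟩` of the SHIFTED instance `(b, v′ + 2D²p₁·b)` (same Step-8 output, different `step9Needs`) is
the member `(0; q₀ − 1, (q_{t+1} + b_{t+1})_t)` of the same base class.
[cite: ChenQuantumLattice2024, eq. (35) p. 31, §3.5.8 pp. 33–34] -/
theorem phi7d_shift_eq_uKet (h : S.Admissible) :
    (S.inst S.b (fun i => S.v' i + 2 * (S.D : ℤ) * S.D * S.p₁ * S.b i)).phi7d
      = (S.cshape (S.cosetOf S.v')).uKet 0 (((S.quotOf S.v' 0 : ℤ) : ZMod S.Q) - 1)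
          (fun t => ((S.quotOf S.v' t.succ : ℤ) : ZMod S.Q) + ((S.b t.succ : ℤ) : ZMod S.Q)) := by
  have hfun : (fun i => S.v' i + 2 * (S.D : ℤ) * S.D * S.p₁ * S.b i)
      = fun i => S.v' i + S.L * S.b i := by
    funext i
    simp only [Shape.L]
  rw [hfun, S.phi7d_inst_shift_eq_uKet h S.b, h.b_head]
  push_cast
  congr 1
  first | rfl | ring

/-! ## Part X.  The class theorem and the order for squarefree `Q` -/

/-- `A ≠ 0` in `ℤ_Q` for a proper factorisation `Q = A·C`, `C > 1`. [folklore] -/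
theorem natCast_left_ne_zero {A C : ℕ} (hQ : (S.Q : ℕ) = A * C) (hC : 1 < C) :
    ((A : ZMod S.Q)) ≠ 0 := by
  intro h0
  rw [ZMod.natCast_eq_zero_iff] at h0
  have hA : 0 < A := pos_left_of_eq_mul (Q := (S.Q : ℕ)) hQ
  have hle : (S.Q : ℕ) ≤ A := Nat.le_of_dvd hA h0
  have hlt : A < (S.Q : ℕ) := by
    rw [hQ]
    exact lt_mul_of_one_lt_right hA hC
  exact absurd hle (not_le.2 hlt)

/-- **THEOREM (Y1) — failure at `1/minFac(C)²` for EVERY divisor `C > 1` of `Q` (no coprimality).**  For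
every factorisation `Q = A·C` with `C > 1` and every coordinate set `U` there is a two-outcome POVM on the
Step-8 register which is `(1/minFac(C)²)`-almost sure on the whole Karst-wave class `InClass U` of `S` and
nevertheless gives `S` and the shifted instance `(b, v′ + 2D²p₁b)` — same Step-8 output `y′, u`, different
`step9Needs` — DIFFERENT almost-certain outcomes.  With `C = Q` this is the tree's
`step8_povm_ceiling_fails_at_inv_minFac_sq`; with `C = p` prime it gives failure at `1/p²` for every prime
`p ∣ Q` (below).  The VALUE is a THEOREM about a WITHDRAWN algorithm — not summit progress.
[cite: ChenQuantumLattice2024, §3.1 p. 22, Cond. C.3 p. 18, eq. (35) p. 31, §3.5.8 pp. 33–34;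
NielsenChuang2010, §2.2.6 p. 90] -/
theorem step8_povm_ceiling_fails_at_inv_minFac_divisor_sq (h : S.Admissible)
    (U : Finset (Fin (S.n + 1))) {A C : ℕ} (hQ : (S.Q : ℕ) = A * C) (hC : 1 < C) :
    ∃ (E : POVM (Fin (S.n + 1) → ZMod S.M) (Fin 2)) (k k' : Fin 2),
      S.AlmostSureOn (1 / (C.minFac : ℝ) ^ 2) U E ∧ k ≠ k'
      ∧ E.AlmostCertain (1 / (C.minFac : ℝ) ^ 2) S.phi7d k
      ∧ E.AlmostCertain (1 / (C.minFac : ℝ) ^ 2)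
          (S.inst S.b (fun i => S.v' i + 2 * (S.D : ℤ) * S.D * S.p₁ * S.b i)).phi7d k' := by
  classical
  obtain ⟨c₀, x₀, y₀, hφS, hφS'⟩ : ∃ (c₀ : S.Coset) (x₀ : ZMod S.Q) (y₀ : Fin S.n → ZMod S.Q),
      S.phi7d = (S.cshape c₀).uKet 0 x₀ y₀
      ∧ (S.inst S.b (fun i => S.v' i + 2 * (S.D : ℤ) * S.D * S.p₁ * S.b i)).phi7d
          = (S.cshape c₀).uKet 0 (x₀ - 1) (fun t => y₀ t + ((S.b t.succ : ℤ) : ZMod S.Q)) :=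
    ⟨_, _, _, S.phi7d_eq_uKet h, S.phi7d_shift_eq_uKet h⟩
  have h₀ : (S.cshape c₀).Admissible := S.cshape_admissible h c₀
  have hmF : (0 : ℝ) < (C.minFac : ℝ) := by exact_mod_cast Nat.minFac_pos C
  have hε : (0 : ℝ) ≤ 1 / (C.minFac : ℝ) ^ 2 := by positivity
  refine ⟨(S.cshape c₀).orbitPOVM h₀ A x₀ y₀, 0, 1, ?_, by decide, ?_, ?_⟩
  · -- almost sure on the whole class
    intro b₂ v₂ hI
    obtain ⟨c, β, x, yb, hφ, -⟩ :=
      S.exists_cmember_of_inClass h (T := Finset.univ) (fun t _ => Finset.mem_univ t) hI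
    rw [hφ]
    by_cases hc : c₀ = c
    · subst hc
      exact (S.cshape c₀).divisorOrbit_almostCertain h₀ hQ hC x₀ y₀ β x yb
    · exact ⟨1, POVM.ofFrameBinary_almostCertain_one_of_orthogonal _ _ _ _ hε fun j =>
        S.star_uKet_dotProduct_cmember_ne h hc 0 _ _ β x yb⟩
  · -- `S` itself: outcome 0 (it is the orbit member `(r, s̄) = (0, 0)`)
    rw [hφS]
    have hj : (S.cshape c₀).uKet 0 x₀ y₀
        = (S.cshape c₀).orbitVec A x₀ y₀ ⟨(0, 0), by simp⟩ := by
      simp only [orbitVec, add_zero]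
    rw [hj]
    exact POVM.ofFrameBinary_almostCertain_zero_self _ _ _ _ hε
  · -- the shifted instance: outcome 1 (it is orthogonal to the whole orbit, as `A·(−1) ≠ 0`)
    rw [hφS']
    have hA0 : ((A : ZMod S.Q)) ≠ 0 := S.natCast_left_ne_zero hQ hC
    refine POVM.ofFrameBinary_almostCertain_one_of_orthogonal _ _ _ _ hε fun j => ?_
    show star ((S.cshape c₀).uKet 0 (x₀ + j.1.1) (y₀ + j.1.2))
      ⬝ᵥ (S.cshape c₀).uKet 0 (x₀ - 1) (fun t => y₀ t + ((S.b t.succ : ℤ) : ZMod S.Q)) = 0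
    rw [(S.cshape c₀).star_uKet_dotProduct_uKet_same h₀, if_neg]
    rintro ⟨hx, -⟩
    have hr : j.1.1 = -1 := by linear_combination hx
    have hj := j.2.1
    rw [hr, mul_neg, mul_one, neg_eq_zero] at hj
    exact hA0 hj

/-- **COROLLARY (Y2) — failure at `1/p²` for every prime `p ∣ Q`.**  In particular at `1/𝔭(Q)²`, `𝔭(Q)` the
LARGEST prime factor of `Q` — improving the tree's `1/minFac(Q)²`. [cite: ChenQuantumLattice2024, §3.1 p. 22,
Cond. C.3 p. 18; NielsenChuang2010, §2.2.6 p. 90] -/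
theorem step8_povm_ceiling_fails_at_inv_prime_sq (h : S.Admissible) (U : Finset (Fin (S.n + 1)))
    {p : ℕ} (hp : p.Prime) (hpQ : p ∣ (S.Q : ℕ)) :
    ∃ (E : POVM (Fin (S.n + 1) → ZMod S.M) (Fin 2)) (k k' : Fin 2),
      S.AlmostSureOn (1 / (p : ℝ) ^ 2) U E ∧ k ≠ k'
      ∧ E.AlmostCertain (1 / (p : ℝ) ^ 2) S.phi7d k
      ∧ E.AlmostCertain (1 / (p : ℝ) ^ 2)
          (S.inst S.b (fun i => S.v' i + 2 * (S.D : ℤ) * S.D * S.p₁ * S.b i)).phi7d k' := by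
  have hQ : (S.Q : ℕ) = (S.Q : ℕ) / p * p := (Nat.div_mul_cancel hpQ).symm
  have := S.step8_povm_ceiling_fails_at_inv_minFac_divisor_sq h U hQ hp.one_lt
  rw [hp.minFac_eq] at this
  exact this

/-- **THEOREM (Y3) — the ORDER for squarefree `Q` (Chen's `Q = p₂⋯p_κ`, distinct odd primes).**  For
squarefree `Q` and any coordinate set `U` containing some `t + 1`:
(sufficiency) every POVM which is `ε`-almost sure on the class with `4ε·p² < 1` for EVERY prime `p ∣ Q`
gives `S` and the shifted instance the same almost-certain outcome (tree, Part VIII of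
`MeasurementThreshold`, applied to the factorisation of `Q` into its primes); (failure) at `ε = 1/p²` for
ANY prime `p ∣ Q` some almost-sure POVM separates them.  Hence the threshold is of ORDER EXACTLY
`1/𝔭(Q)²`, `𝔭(Q) = max prime factor` — for Chen's parameters (Cond. C.3: `pᵢ ≤ poly log n`) inverse
POLYLOGARITHMIC in `n`, at both ends.  This settles, for squarefree `Q`, the order left open in
`step8_povm_ceiling_fails_at_inv_minFac_sq`; for `Q` with square factors the window
`[1/(4·max pᵢ^{2aᵢ}), 1/𝔭(Q)²]` remains.  A THEOREM about a WITHDRAWN algorithm — not summit progress.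
[cite: ChenQuantumLattice2024, §3.1 p. 22, Cond. C.3 p. 18, §3.5.8 pp. 33–34, p. 37;
NielsenChuang2010, §2.2.6 p. 90] -/
theorem step8_povm_ceiling_order_squarefree (h : S.Admissible) (hsq : Squarefree (S.Q : ℕ))
    (U : Finset (Fin (S.n + 1))) :
    (∀ {κ : Type} [Fintype κ] [DecidableEq κ] (t₁ : Fin S.n), t₁.succ ∈ U →
        ∀ (E : POVM (Fin (S.n + 1) → ZMod S.M) κ) {ε : ℝ},
          (∀ p ∈ (S.Q : ℕ).primeFactors, 4 * ε * (p : ℝ) ^ 2 < 1) →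
          S.AlmostSureOn ε U E →
            ∀ k k' : κ, E.AlmostCertain ε S.phi7d k →
              E.AlmostCertain ε (S.inst S.b (fun i => S.v' i + 2 * (S.D : ℤ) * S.D * S.p₁ * S.b i)).phi7d k'
                → k = k')
    ∧ ∀ p ∈ (S.Q : ℕ).primeFactors, ∃ (E : POVM (Fin (S.n + 1) → ZMod S.M) (Fin 2)) (k k' : Fin 2),
        S.AlmostSureOn (1 / (p : ℝ) ^ 2) U E ∧ k ≠ k'
        ∧ E.AlmostCertain (1 / (p : ℝ) ^ 2) S.phi7d k
        ∧ E.AlmostCertain (1 / (p : ℝ) ^ 2)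
            (S.inst S.b (fun i => S.v' i + 2 * (S.D : ℤ) * S.D * S.p₁ * S.b i)).phi7d k' := by
  classical
  refine ⟨fun t₁ ht₁ E ε hε hE k k' hk hk' => ?_, fun p hp => ?_⟩
  · have h₃' : (S.inst S.b (fun i => S.v' i + 2 * (S.D : ℤ) * S.D * S.p₁ * S.b i)).Admissible :=
      S.inst_admissible h h.b_head h.b_tail fun i =>
        dvd_add (h.v'_in_DZ i) ⟨2 * S.D * S.p₁ * S.b i, by ring⟩
    have hS : S.InClass U S.b S.v' := ⟨fun _ _ => rfl, h⟩
    have hS₃ : S.InClass U S.b (fun i => S.v' i + 2 * (S.D : ℤ) * S.D * S.p₁ * S.b i) :=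
      ⟨fun _ _ => rfl, h₃'⟩
    have hprod : ∏ p ∈ (S.Q : ℕ).primeFactors, (id p) = (S.Q : ℕ) :=
      Nat.prod_primeFactors_of_squarefree hsq
    have hcop : ((S.Q : ℕ).primeFactors : Set ℕ).Pairwise fun i j => Nat.Coprime (id i) (id j) :=
      fun i hi j hj hij => (Nat.coprime_primes (Nat.prime_of_mem_primeFactors hi)
        (Nat.prime_of_mem_primeFactors hj)).2 hij
    exact S.step8_povm_ceiling_pairwiseCoprime h U t₁ ht₁ E (S.Q : ℕ).primeFactors id hprod hcop
      (fun i hi => hε i hi) hE hS hS₃ 1 (fun _ => 0) rfl (fun _ _ => rfl)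
      (fun i => by push_cast; ring) hk hk'
  · exact S.step8_povm_ceiling_fails_at_inv_prime_sq h U (Nat.prime_of_mem_primeFactors hp)
      (Nat.dvd_of_mem_primeFactors hp)

end Shape

end Literature.Computability.Cryptography.Chen2024
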